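import Summits.ResolutionOfSingularities.ResolutionOfSingularities.Theses.EquisingularLift
import Summits.ResolutionOfSingularities.ResolutionOfSingularities.Theorems.EquisingularLiftEquisingularLiftNatEmbeddedLiftFactDefs
import Summits.ResolutionOfSingularities.ResolutionOfSingularities.Theorems.EquisingularLiftEquisingularLiftNatTowerRationalDefs
import Literature.AlgebraicGeometry.Resolution.BlowupsRelativeCartier
import Literature.AlgebraicGeometry.Resolution.NuEliminationBoundaryNEReachable
import Summits.ResolutionOfSingularities.ResolutionOfSingularities.Theorems.EquisingularLiftEquisingularLiftCentreBlowupFlatExceptional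

/-!
# idea-3 `generic-germ-clock` (rounds 4–5, desk CHAIN v7.50 / v7.51 §7 ASK (g); v5 = r7 sharpenings) — AGED MEMO states · FORESEE typed · the R1 customer · F2 typed · `BPermissible` conjunct · shape re-targeted

res-L1-w45b-idea-3 g4 (crux-ideate on stmt-ResolutionOfSingularities-20148 = `EquisingularLiftNatThree`). This is v12 (= v11 7a05deb6ef28 / e774cde5026233fa + the F-shape-case discharge of the trace lemmas' hypotheses, PROVED: `isClosedImmersion_specMap_of_surjective`,
`ShadowReach.isClosedImmersion_of_surjective` (every carried presentation is a closed immersion for `θ` surjective), `ShadowReach.trace_step_exact_of_surjective`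
(trace exactness needing only `Y` over the image of `Spec k`); no type touched); v11 (= v10 + S-G11 of BOTH critics PROVED: trace exactness lemmas `ShadowReach.trace_subset` /
`trace_subset_range` / `trace_step_eq` / `ShadowReach.trace_step_exact` — the derived downstairs trace `j ⁻¹' Y'` is `Run`-exact (kept derived on purpose);
+ crit-3 S-G12 wording in `stub_R1a`'s docstring); v10 (= v9 + crit-3 TRIAGE-r10-3 F-C, MATERIAL, repair C1: the DOWNSTAIRS aged boundary `B₀` is CARRIED as stage
data in `StagePred` / `ShadowReach` / `ServesNextOn` / `ServesAlongOn` (root `[]`, step = `Run.step`'s recipe along `ρ`), no longer derived as `B'.map (j ⁻¹' ·)`;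
`next` / `push` / `cls` / `WellShaped` read `B₀`; hosts keep the upstairs `B'`; new proved lemma `ShadowReach.head?_eq`; every lemma re-proved); v9 (= v8 + crit-3 TRIAGE-r9-3 F-B: the `BPermissible` docstring sentence «𝓑-permissible by construction» RETRACTED as it
stood and re-stated relative to the strict-transform transport, both witnesses recorded; no declaration changed); v8 = v7 + crit-2 TRIAGE-r9-2 S-G7, MATERIAL:
old boundary entries are now carried by STRICT transform `closure (τ⁻¹ (E ∖ V(centre)))` in `Run.step`, `ShadowReach` and the `Serves*` continuations
(total preimage made `BPermissible` blind — false-accept witness (u,v,w), E_new = {u=0}, old entry {uv=0}, Z = V(u, v−w²)); every lemma re-proved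
unchanged; + TRIAGE-r8-2 S-G5: the germ-clock row R3 gets a TYPED class `clsR3carrier` and a named target Prop `TargetR3` (no truth claimed); v7 = v6 + S-G4 STATED AND PROVED as a lemma,
`IsoInvariant.comap_eq_of_next_start`: the first centre of an iso-invariant selector is `Aut(S, Y)`-invariant — desk 08:52:20Z (4); v6 = v5 with the F2
flatness lemma PROVED by name from the tree, sorries 4 → 3; v5 = v4 8f0373144aee / 72bedb5fa8902729 + the panel's r7 sharpenings: crit-2 TRIAGE-r7-2 S-G3/S-G4, crit-3
TRIAGE-r7-3 (a)/(b); statement TYPES of the shapes and of `CJSSelectorExists` unchanged); v4 (= v3 2ee96c798edf /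
b5bb8c82339eaf13 + the MEMO repair of crit-2 TRIAGE-r5-2 F1 + F2 typed + the one flatness lemma isolated, desk CHAIN v7.51 §7 (g); v3 = v2 747f6859d5b2 +
the §D paragraph «the precise age ≥ 1 obstruction», crit-3 TRIAGE-r5-3 (B)(a)) of the workfile `Cruxes/EquisingularLiftNatThree/GermClockSupplement.lean`
(v1 = commit 139ec31759b7, sha16 6bba1313d0a73102, round 3, R16 (iii)).
OURS, planning vocabulary and one elementary commutative-algebra lemma; AI-written, gate-checked, weaker than expert review; counted 0; NO summit
statement and no crux is proved here; nothing of [Hironaka2017] is asserted. The `stub_*` theorems of this file are typed PLUMBING / ENGINE targets of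
the idea card, NOT skeleton stubs (R10 / R16 (ii)), not registered. Companions: `GermClockRatFinite.lean` (round 2, commit 5215bca18102) and `GermClockDeltaSquare.lean` (round 5; v3 crux commit ae8450660958,
sha16 3c13707005726514: the localisation square of §E typed AND PROVED — SORRY-FREE, `germDelta_round_lt` / `germDelta_round_eq_of_not_mem`).

CHANGELOG v1 → v2 (answers crit-3 TRIAGE-r3-3 typing finding + sharpen (a)(b); crit-2 TRIAGE-r3-2 sharpen (1)(2)(3); desk §7 (g) items (0)–(3)):
* §A UNCHANGED byte-for-byte (`blowupQuot`, `delta_descent` PROVED, `stub_delta_descent`).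
* §B (0) AGED BOUNDARY. The selector state is `(S, Y, B)` with `B : List (Set S)` ordered by AGE (head = youngest exceptional trace): `Run.step` and
  `ShadowReach` PUSH the new exceptional trace and pull the older entries back; `WellShaped` reads `⋃ B`; `IsoInvariant` transports the list (ambient
  isomorphisms only — crit-2 (3)). `ShadowReach.root` / `ShadowReach.step` proved. (v1's history-free `B : Set S` could not host the Cossart–Jannsen–Saito
  strategy, which reads the OLD/NEW filtration of the boundary — crit-3's finding; with ages, CJS 2020 Thm 1.4 + §§5–6 is a candidate inhabitant of
  `CJSSelectorExists`.)
* §C (2) FORESEE TYPED. `ServesAlong Good` / `Foresees` = prefix-coherent lifting: an INVARIANT `Good` of upstairs stages, true at the root, such that at a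
  `Good` stage the selected centre has a regular `O`-flat lift every blow-up of which is again `Good`; `ServesAlongOn cls Good` = its class-restricted form
  WITH A ROBUSTNESS CLAUSE (out-of-class selected centres: every regular flat lift keeps `Good`), which is exactly what makes rows COMPOSABLE. Proved:
  `ServesNextOn cls → ServesAlongOn cls ShadowReach` (every ∀-row is a FORESEE row with the universal invariant), `ServesAlongOn.union` (disjoint classes
  compose, invariants conjoin), `ServesAlongOn.servesAlong_of_cover`, `ServesNext → Foresees`. The crux-currency wrapper `SupplementWith Φ` (the binder
  prefix of the crux, then `∃` char-0 DVR `O ↠ k`, then `Φ` on `ℙ³_O ⊇ Y = H`) gives `TerminationSupplementA = SupplementWith ServesNext` (v1's text,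
  refactored definitionally) and the WEAKER `ForeseeSupplementA = SupplementWith Foresees`; `SupplementWith.mono` and
  `terminationSupplementA_foresee : TerminationSupplementA → ForeseeSupplementA` proved. The SHAPE is RE-TARGETED to the weaker hypothesis:
  `stub_supplementF_shape` (this file's shape `sorry`); v1's `stub_supplementA_shape` (same name, same statement) is now DERIVED from it by
  `terminationSupplementA_foresee` — no `sorry` of its own, conditional on the shape stub like everything downstream of it.
* §D (1) the R1 CUSTOMER `servesNextOn_R1 : EmbeddedLiftFact → WellShaped → … → ServesNextOn clsR1` in the ∀-form, KERNEL-REDUCED to two typed pieces: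
  `stub_R1a` (PLUMBING: at a shadow-reachable stage the youngest boundary entry is the support of a regular closed subscheme `W`, proper and `O`-flat, whose
  special fibre is the REDUCED subscheme on the youngest entry downstairs — the fresh exceptional divisor `ℙ(N_C) → C`) and `stub_R1b` (ENGINE =
  `EmbeddedLiftFact` (J1 / F-88 lineage; a HYPOTHESIS here exactly as in CHILD v33) + push-forward along `W ↪ X'` + «flat over `O`, proper, regular special
  fibre ⇒ regular»). AGE PRINCIPLE (heuristic, §D; made precise for age 0 by `stub_R1a`): what survives ARBITRARY earlier lifts is the age-0 datum, so a
  class reading only the youngest entry is served in the ∀-form; age ≥ 1 readers (R2 / R3 / R3′) are expected to need FORESEE.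
* §E (3) the δ-DROP BY NAME: nothing left to type for the presentation — the tree already presents the blow-up of a curve at a closed point as an
  `IsFirstNeighbourhood` family and proves the strict δ-drop for it and for embedded strict transforms (`IsBlowup.isFirstNeighbourhood_fibreSubalgebra`,
  `IsBlowup.sum_curveDelta_fibre_lt`, `IsBlowup.finsum_pointDelta_lt`, `IsBlowup.finsum_pointDelta_strictTransform_lt`; flat base change
  `IsBlowup.of_isPullback_of_flat`). What the generic-germ clock still needs is the LOCALISATION SQUARE only (stated in prose in §E; typed since in `GermClockDeltaSquare.lean`).
CHANGELOG v3 → v4 (crit-2 TRIAGE-r5-2 F1 / F2 + sharpen S1 / S2; desk CHAIN v7.51 §7 (g)):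
* §B MEMO (F1 / S1). `Selector` gains `Memo : Scheme → Type`, `init`, `push` (update along a blow-up step with its centre), `transport` (along isomorphisms);
  `next` reads `(S, Y, B, μ)`; `WellShaped` for every memo; `IsoInvariant` = (next / init / push)-equivariance under ambient isomorphisms; `Run` / `Resolves`
  thread the memo from `init`; a `ShadowReach` stage CARRIES a presentation `(X₀, j, t)` of its special fibre and the downstairs memo `μ : Memo X₀`, a step
  records the induced downstairs `ρ` with `IsBlowup ρ D` and pushes the memo along it; new proved lemmas `ShadowReach.isPullback` (the carried presentation
  is a model square) and `ShadowReach.step_pullback` (F2 TYPED: the fibre-product presentation of the next stage is reachable and its `ρ` IS `Bl_D X₀`, by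
  the tree's `IsBlowup.of_isPullback_of_flat_exceptional`, given the instance `Flat (E_C → Spec O)`); `ServesNextOn` drops its separate model-square
  hypothesis (derivable). Reason: CJS's strategy (LNM 2270) carries a history function `O(x) ⊆ 𝓑(x)` (Def. 4.6, p. 55; RESET rule (4.6), p. 57) and
  component labels ((6.5), p. 92) which the aged state `(S, Y, B)` does not determine; all of it is ONE instance of `Memo`.
* §C stage predicates `StagePred` (presentation + memo); `ServesAlongOn` / `ServesAlong` / `Foresees` re-threaded (root clause for EVERY presentation with
  the start memo; continuation = blow-up + presentation + induced downstairs blow-up + pushed memo); `servesAlongOn`, `union`, `servesAlong_of_cover`,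
  `foresees` re-proved.
* §D `exceptional_flat` (S2) = the ONE plumbing lemma `Flat (E_C → Spec O)` for a regular `O`-flat centre in a regular scheme, consumed by
  `ShadowReach.step_pullback` and named in the routes of `stub_supplementF_shape` / `stub_R1a`, whose docstrings now cite the tree's
  `IsBlowup.of_isPullback_of_flat_exceptional` / `CentreSeq.isPullback_comap_specMap_of_exceptionalFlatOver` instead of a «missing square» (F2); `stub_R1a`
  re-stated on memo stages (presentation carried); `servesNextOn_R1` / `servesAlongOn_R1` re-proved; `CJSSelectorExists` says where CJS's `(O, labels)` go
  and adds crit-2's sanity test. Statement TYPES of `stub_supplementF_shape` / `stub_supplementA_shape` / `CJSSelectorExists` unchanged verbatim (their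
  meaning changed through the definitions).
CHANGELOG v5 (r7 PASS/PASS concordant; sharpenings acted on, nothing else touched):
* crit-2 S-G3: `stub_exceptional_flat` (v6: `exceptional_flat`, proved) gains `[IsLocallyNoetherian X₁]` (the projective-bundle route needs the centre's ideal coherent; every consumer has
  `X₁` of finite type over a DVR) — not load-bearing, the lemma is used nowhere else in this file (it names the instance hypothesis of `ShadowReach.step_pullback`).
* crit-2 S-G4: the docstring of `CJSSelectorExists` states the NON-VACUITY TEST the panel converged on (crit-3 r7 evidence 2 = crit-2 S-G4): at a START state,
  (init) + (next) of `IsoInvariant` force the first selected centre to be `Aut(S, Y)`-invariant — the clause a `Classical.choice` inhabitant of a bare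
  existence theorem cannot meet and CJS meets by canonicity (LNM 2270 Thm. 6.9 (F1) / Prop. 6.31).
* crit-3 (a): NEW named conjunct `Selector.BPermissible` — every selected centre is normal crossing with the (reduced) aged boundary at every point of its
  support, typed with the tree's `Literature.AlgebraicGeometry.Resolution.IsNormalCrossingWithBoundaryAt` (CJS Def. 5.2, LNM 2270 p. 67; Def. 5.4 p. 68 for
  `𝓑`-permissible) on the reduced ideals `redIdeal` of the boundary entries — and the STRENGTHENED slot `CJSSelectorExistsB := ∃ sel, WellShaped ∧ BPermissible ∧
  IsoInvariant ∧ ∀ k, Resolves k` with `CJSSelectorExistsB.weaken : CJSSelectorExistsB → CJSSelectorExists` (proved).  `CJSSelectorExists` itself is kept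
  BYTE-IDENTICAL in type (lead-2's slot (b) target per desk R20-bis does not move); rows that consume 𝓑-permissibility (jump-class-steering R3-3, tower-hilbert-
  closure member retention) cite `BPermissible` by name, rows that do not stay selector-agnostic as `servesNextOn_R1` is.
* crit-3 (b): `ShadowReach`'s docstring records that the step does NOT require `ρ ≫ t₁ = t₂` (automatic when `θ` is surjective, `Spec k → Spec O` mono — the
  only case `SupplementWith` instantiates; a harmless widening otherwise) — provers of `stub_R1a` must not assume the continuation square is the chosen fibre
  product.  (c) noted (push asked for all `ρ`; fine).  (d) the (a″) degree test stays UNRUN (no kit on idea-3 / crit-2 / crit-3) and custodied to the first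
  kit-enabled hand.
* §E: the localisation square is now PROVED sorry-free in `GermClockDeltaSquare.lean` v3 (crux commit ae8450660958).
* v12 (consolidation, unprompted; critics' ledgers empty at r13/r14): three corollaries discharging `hR` / `[IsClosedImmersion j₂]` for `θ` surjective; nothing else.
* v11 (crit-2 TRIAGE-r13-2 S-G11 = crit-3 TRIAGE-r12-3 S-G11, proved; S-G12 wording): four trace-exactness lemmas after `ShadowReach.head?_eq`; nothing else.
* v10 (crit-3 TRIAGE-r10-3 F-C, material — knock-on of the v8 strict transport that neither r9 read priced: for an OLDER entry `E`, `j₂⁻¹ St(E)` can be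
  STRICTLY LARGER than the downstairs strict transform when the lift `C` meets `E` non-flatly over `O` (witness: `X₁` smooth of rel. dim 3, `E = {a=0} ∋ D`,
  `C = (ϖ^m,0,0)`: `C ∩ E = Spec O/ϖ^m`, `St(E) = Bl_{C∩E} E ⊇ F_k`), so the derived reading handed `sel.next` a state no `Run` reaches and the F-shape's
  transport invariant failed after the first such lift): REPAIR C1 as crit-3 typed it — `StagePred` gains the downstairs list `B₀ : List (Set X₀)`;
  `ShadowReach` root has `B₀ = []`, its step transports `B₁₀ ↦ (ρ⁻¹ V(D)) :: B₁₀.map (E ↦ closure (ρ⁻¹ (E ∖ V(D))))` = `Run.step`'s recipe VERBATIM along the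
  induced `ρ`; `ServesNextOn` / `ServesAlongOn` / `servesAlong_of_cover` query `sel.next X₀ (j⁻¹ Y') B₀ μ`, classify `cls X₀ (j⁻¹ Y') B₀ D`, push
  `sel.push ρ (j⁻¹ Y') B₀ D μ`; `stub_R1a` / `stub_R1b` keep reading the UPSTAIRS head (hosts), linked to `clsR1`'s downstairs head by the new PROVED
  `ShadowReach.head?_eq`; alternative C2 («`C` meets every entry `O`-flatly» as a lift hypothesis) NOT taken — it is §D's age ≥ 1 obstruction, row-level.
  Unchanged: `Run`, `Resolves`, `WellShaped`, `IsoInvariant`, `BPermissible`, `CJSSelectorExists[B]`, `clsR1`, `clsR3carrier`, `TargetR3`, the three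
  sorried statements' TYPES up to the new stage arity (`stub_R1a` gains the binder `B₀`), `GermClockDeltaSquare`.
* v8 (crit-2 TRIAGE-r9-2 S-G7, material; TRIAGE-r8-2 S-G5/S-G6): boundary entries of age ≥ 1 are STRICT transforms (one-token fix S-G7 names, applied at
  all seven τ-sites: `Run.step`, `ShadowReach` (def + `step` + `step_pullback`), `ServesAlongOn` (serve)/(robust), `Foresees`-side `SupplementWith`);
  iso-transport sites (`e.hom ⁻¹' E`) and special-fibre restriction sites (`j ⁻¹' E`) untouched (preimage under an isomorphism / a closed immersion of the
  fibre IS the right reading there); §D end: `clsR3carrier` (stage with `B ≠ []`, selected centre through a point of the reduced trace closure with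
  one-dimensional NON-regular local ring, centre reduced there) and `TargetR3 := ∃ Good, ServesAlongOn clsR3carrier … Good` — the typed statement the
  (a″) specimen must falsify for the CJS inhabitant (S-G5; a `def`, not a sorried theorem: nothing is claimed for arbitrary selectors); S-G6 recorded in
  `GermClockDeltaSquare.lean` v4's docstring (instance route `IsIntegral S'` ← `IsBlowup.isIntegral`).
* v7 (desk DESK WORDS 08:52:20Z (4) «S-G4 … state it as a lemma target»): `IsoInvariant.next_start_map_comap` / `IsoInvariant.comap_eq_of_next_start` PROVED —
  at a start state `(S, Y, [], init S Y)` every automorphism `e` of `S` with `e.hom ⁻¹' Y = Y` fixes the selected first centre (`D.comap e.hom = D`).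
* v6: `exceptional_flat` (ex `stub_exceptional_flat`, the F2 plumbing lemma `Flat (E_C → Spec O)`) is PROVED BY NAME from the tree: the line `strata-split`'s
  `Summit.….Cruxes.EquisingularLift.StrataSplit.flat_exceptional_of_isBlowup_regularCentre` (Theorems/EquisingularLiftEquisingularLiftCentreBlowupFlatExceptional.lean,
  [Liu2002 Thm. 8.1.19 (b)]) states it verbatim, `[IsLocallyNoetherian U]` included — so S-G3's binder was exactly the tree's hypothesis.
SORRY INVENTORY (v10 = v8 = v7 = v6): `stub_supplementF_shape` (shape; plumbing M/L), `stub_R1a` (plumbing M/L), `stub_R1b` (plumbing M modulo the hypothesis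
`EmbeddedLiftFact`) — THREE. Everything else in the file is proved (incl. `delta_descent`, the `ShadowReach`/`Serves*` calculus, `exceptional_flat`). (T-b) — «a greedy served-class process terminates» — is NOT
claimed anywhere.
-/

set_option linter.dupNamespace false

noncomputable section

open CategoryTheory AlgebraicGeometry TopologicalSpace
open Literature.AlgebraicGeometry.Resolution (IsBlowup)
open Literature.AlgebraicGeometry.Morphisms (CechMH1)
open Literature.AlgebraicGeometry.HodgeTheory (normalSheaf)

namespace Summit.ResolutionOfSingularities.ResolutionOfSingularities.Cruxes.EquisingularLiftNat.Sections.GermClock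

open IsLocalRing

/-! ## §A — the δ-clock ticks (`delta_descent`, proved) -/

/-- The quotients `(Iⁿ : Iⁿ)_K = {q ∈ K | q·Iⁿ ⊆ Iⁿ}` for some `n ≥ 1`: the affine blow-up algebra of
`I` seen inside `K` at the level the germ clock uses (for `I = 𝔪` of a one-dimensional local domain
these rings exhaust the first-neighbourhood ring). -/
def blowupQuot (A K : Type*) [CommRing A] [Field K] [Algebra A K] (I : Ideal A) : Set K :=
  {q | ∃ n, 0 < n ∧ ∀ a ∈ Submodule.map (Algebra.linearMap A K) (I ^ n),
    q * a ∈ Submodule.map (Algebra.linearMap A K) (I ^ n)}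

/-- **δ-descent (the clock ticks).** A one-dimensional Noetherian local domain `(A, 𝔪)` which is not
a discrete valuation ring acquires a NEW integral element already in `(𝔪 : 𝔪)_K ⊆ blowupQuot`:
there is `q ∈ K` with `q·𝔪 ⊆ 𝔪`, `q` integral over `A`, `q ∉ A`. Proof: `𝔪 ∈ Ass(A/xA)` for any
`0 ≠ x ∈ 𝔪` gives `y ∉ xA` with `𝔪y ⊆ xA`; `q = y/x ∉ A` and `q𝔪 ⊆ A`; if `q𝔪 ⊄ 𝔪` some `qm₀`
is a unit and `𝔪 = m₀A` is principal, so `A` is a DVR (`IsDiscreteValuationRing.TFAE`),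
contradiction; hence `q𝔪 ⊆ 𝔪` and `q` is integral by the determinant trick
(`isIntegral_of_smul_mem_submodule`). No finiteness of the normalisation and no residue-field
hypothesis is used (the germ clock runs over the imperfect field `k(Z)`). Compare the tree's
`Literature.AlgebraicGeometry.Resolution.IsFirstNeighbourhood.exists_mem_iInf_notMem_bot` /
`sum_curveDelta_lt` (same growth for the first-neighbourhood ring presented as `⋂ Sᵢ`, under
module-finite normalisation, with the strict drop `Σ δ(Sᵢ) < δ(A)` — that is the clock's strict
monotonicity). [Kiyek–Vicente, Resolution of Curve and Surface Singularities, II (4.7)–(4.8);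
Kollár 2007 §1.4] -/
theorem delta_descent {A K : Type*} [CommRing A] [IsDomain A] [IsNoetherianRing A] [IsLocalRing A]
    [Field K] [Algebra A K] [IsFractionRing A K]
    (h1 : ringKrullDim A = 1) (hA : ¬ IsDiscreteValuationRing A) :
    ∃ q ∈ blowupQuot A K (maximalIdeal A),
      q ∈ integralClosure A K ∧ q ∉ Set.range (algebraMap A K) := by
  classical
  have hnf : ¬ IsField A := (ringKrullDim_eq_one_iff_of_isLocalRing_isDomain.mp h1).1
  have hm0 : maximalIdeal A ≠ ⊥ := isField_iff_maximalIdeal_eq.not.mp hnf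
  haveI : Ring.KrullDimLE 1 A := Ring.krullDimLE_iff.mpr h1.le
  haveI : Ring.DimensionLEOne A :=
    ⟨fun hne hp => (Ring.krullDimLE_one_iff_of_noZeroDivisors.mp inferInstance) _ hne hp⟩
  have hinj : Function.Injective (algebraMap A K) := IsFractionRing.injective A K
  -- a nonzero element `x ∈ 𝔪`
  obtain ⟨x, hx𝔪, hx0⟩ : ∃ x ∈ maximalIdeal A, x ≠ 0 := Submodule.exists_mem_ne_zero_of_ne_bot hm0
  have hxK : algebraMap A K x ≠ 0 := fun h => hx0 (hinj (by rw [h, map_zero]))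
  -- `𝔪` is an associated prime of `A ⧸ (x)`
  set I : Ideal A := Ideal.span {x} with hI
  have hItop : I ≠ ⊤ := by
    rw [hI, Ne, Ideal.span_singleton_eq_top]
    exact fun hu => (mem_maximalIdeal _).mp hx𝔪 hu
  haveI : Nontrivial (A ⧸ I) := Ideal.Quotient.nontrivial_iff.mpr hItop
  obtain ⟨p, hp⟩ := associatedPrimes.nonempty A (A ⧸ I)
  obtain ⟨hpprime, z, hpz⟩ := (isAssociatedPrime_iff).mp hp
  obtain ⟨y, rfl⟩ := Ideal.Quotient.mk_surjective z
  -- membership in the colon ideal, concretely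
  have hcol : ∀ a : A, a ∈ p ↔ a * y ∈ I := by
    intro a
    rw [hpz, Submodule.mem_colon_singleton, Submodule.mem_bot, Algebra.smul_def,
      Ideal.Quotient.algebraMap_eq, ← map_mul, Ideal.Quotient.eq_zero_iff_mem]
  have hxp : x ∈ p := (hcol x).mpr (Ideal.mul_mem_right _ _ (Ideal.subset_span rfl))
  have hp0 : p ≠ ⊥ := fun h => hx0 (by rw [h] at hxp; exact (Submodule.mem_bot _).mp hxp)
  have hpmax : p.IsMaximal := Ring.DimensionLEOne.maximalOfPrime hp0 hpprime
  have hp𝔪 : p = maximalIdeal A := IsLocalRing.eq_maximalIdeal hpmax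
  -- so: `a ∈ 𝔪 ↔ a * y ∈ (x)`
  have hmem : ∀ a : A, a ∈ maximalIdeal A ↔ a * y ∈ I := fun a => hp𝔪 ▸ hcol a
  have hyI : y ∉ I := by
    intro hy
    have h1mem : (1 : A) ∈ maximalIdeal A := (hmem 1).mpr (by rwa [one_mul])
    exact (Ideal.ne_top_iff_one _).mp (Ideal.IsMaximal.ne_top inferInstance) h1mem
  -- for `m ∈ 𝔪`, `m * y = b * x`
  have hdiv : ∀ m ∈ maximalIdeal A, ∃ b : A, b * x = m * y := fun m hm =>
    Ideal.mem_span_singleton'.mp ((hmem m).mp hm)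
  choose b hb using hdiv
  -- the element `q = y / x`
  set q : K := algebraMap A K y / algebraMap A K x with hq
  have hqm : ∀ m (hm : m ∈ maximalIdeal A),
      q * algebraMap A K m = algebraMap A K (b m hm) := by
    intro m hm
    rw [hq, div_mul_eq_mul_div, div_eq_iff hxK, ← map_mul, ← map_mul]
    exact congrArg (algebraMap A K) (by rw [mul_comm y m]; exact (hb m hm).symm)
  have hqA : q ∉ Set.range (algebraMap A K) := by
    rintro ⟨a, ha⟩
    apply hyI
    have : a * x = y := hinj (by rw [map_mul, ha, hq, div_mul_cancel₀ _ hxK])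
    exact Ideal.mem_span_singleton'.mpr ⟨a, this⟩
  by_cases hcase : ∀ m (hm : m ∈ maximalIdeal A), b m hm ∈ maximalIdeal A
  · -- `q𝔪 ⊆ 𝔪`: `q ∈ (𝔪 : 𝔪)` is integral and new
    set N : Submodule A K := Submodule.map (Algebra.linearMap A K) (maximalIdeal A) with hN
    have hqN : ∀ n ∈ N, q • n ∈ N := by
      intro n hn
      obtain ⟨m, hm, rfl⟩ := Submodule.mem_map.mp hn
      rw [smul_eq_mul, Algebra.linearMap_apply, hqm m hm]
      exact Submodule.mem_map.mpr ⟨b m hm, hcase m hm, rfl⟩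
    refine ⟨q, ⟨1, one_pos, ?_⟩, ?_, hqA⟩
    · intro a ha
      rw [pow_one] at ha ⊢
      exact hqN a ha
    · have hNbot : N ≠ ⊥ := by
        intro hbot
        apply hxK
        have : algebraMap A K x ∈ N := Submodule.mem_map.mpr ⟨x, hx𝔪, rfl⟩
        rw [hbot] at this
        exact (Submodule.mem_bot _).mp this
      have hNfg : N.FG := Submodule.FG.map _ (IsNoetherian.noetherian _)
      show IsIntegral A q
      exact isIntegral_of_smul_mem_submodule N hNbot hNfg q hqN
  · -- some `q m₀ = b₀` is a unit: then `𝔪 = (m₀)` is principal and `A` is a DVR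
    exfalso
    push Not at hcase
    obtain ⟨m₀, hm₀, hb₀⟩ := hcase
    have hu : IsUnit (b m₀ hm₀) := (notMem_maximalIdeal).mp hb₀
    obtain ⟨u, hu'⟩ := hu
    have hle : maximalIdeal A ≤ Ideal.span {m₀} := by
      intro m hm
      -- `b m * x = m * y`, `b m₀ * x = m₀ * y` ⇒ `b m * m₀ = b m₀ * m`
      have hrel : b m hm * m₀ * x = b m₀ hm₀ * m * x := by
        calc b m hm * m₀ * x = m₀ * (b m hm * x) := by ring
          _ = m₀ * (m * y) := by rw [hb m hm]
          _ = m * (m₀ * y) := by ring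
          _ = m * (b m₀ hm₀ * x) := by rw [hb m₀ hm₀]
          _ = b m₀ hm₀ * m * x := by ring
      have hrel' : b m hm * m₀ = b m₀ hm₀ * m := mul_right_cancel₀ hx0 hrel
      refine Ideal.mem_span_singleton'.mpr ⟨(↑u⁻¹ : A) * b m hm, ?_⟩
      calc ↑u⁻¹ * b m hm * m₀ = ↑u⁻¹ * (b m₀ hm₀ * m) := by rw [mul_assoc, hrel']
        _ = ↑u⁻¹ * (↑u * m) := by rw [hu']
        _ = m := by rw [← mul_assoc, Units.inv_mul, one_mul]
    have hge : Ideal.span {m₀} ≤ maximalIdeal A :=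
      (Ideal.span_singleton_le_iff_mem _).mpr hm₀
    have hprinc : (maximalIdeal A).IsPrincipal := ⟨⟨m₀, le_antisymm hle hge⟩⟩
    exact hA (((IsDiscreteValuationRing.TFAE A hnf).out 0 4).mpr hprinc)

/-- The registered name of the germ-clock first lemma (crux idea `generic-germ-clock`, First lemma /
row R1): discharged by `delta_descent`. -/
theorem stub_delta_descent {A K : Type*} [CommRing A] [IsDomain A] [IsNoetherianRing A]
    [IsLocalRing A] [Field K] [Algebra A K] [IsFractionRing A K]
    (h1 : ringKrullDim A = 1) (hA : ¬ IsDiscreteValuationRing A) :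
    ∃ q ∈ blowupQuot A K (maximalIdeal A),
      q ∈ integralClosure A K ∧ q ∉ Set.range (algebraMap A K) :=
  delta_descent h1 hA


/-! ## §B — the TERMINATION SUPPLEMENT (T-a), typed as a SELECTOR INTERFACE on AGED states WITH MEMO (v4)

Honest typing constraints (lead-2 MATCH-CENSUS (M1)–(M3) + (b) CENTRE EXPOSURE; crit-3 TRIAGE-r2-3 (a), TRIAGE-r3-3): the supplement may NOT be
«∃ a served resolving sequence» (collapses to the rung, (M1)), NOT «every B-permissible step lifts» ((M2), false), NOT the blanket local lift
((M3), expected false: negative sections); and the canonical CJS sequence is not a typed object today (`IsBPermissibleSequenceB` is a `Prop`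
inductive that does not expose its centres). So the centres are exposed through an INTERFACE — a `Selector` = a deterministic next-centre rule
on downstairs states `(S, Y, B, μ)` — with its axioms as separate `Prop`s, the CJS process as a separate CONSTRUCTION statement (`CJSSelectorExists`,
NEED-TYPING, not claimed), and (T-a) = `ServesNext sel`: at every upstairs stage reachable by SHADOWING `sel` over `O` (any earlier choices of
lifts), the centre `sel` selects on the special fibre has a regular `O`-flat lift (`EmbeddedLiftFact` idiom `C.comap j = D`). ∀-form, parametric
in `sel`; for the CJS selector it is EXPECTED TO FAIL on the open rows R3/R3′/R4/R7/R8 of the card — `ServesNextOn sel cls` restricts it to a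
CLASS of selected centres, which is how the rows are typed; the prefix-coherent (FORESEE) weakening is §C.
v2 (crit-3's typing finding): the state is AGED — `B : List (Set S)`, head = YOUNGEST exceptional trace, so that a strategy reading the OLD/NEW
filtration of the boundary is expressible; every consumer below only pushes / pulls back / reads `⋃ B` or the head.
v4 (crit-2 TRIAGE-r5-2 F1 = desk CHAIN v7.51 §7 (g)): AGES ARE NOT ENOUGH for [Cossart–Jannsen–Saito 2020, LNM 2270] as printed. Its strategy carries a
HISTORY FUNCTION `O : X → {subsets of 𝓑}` (Def. 4.6, p. 55: (O1) `O(x) ⊆ 𝓑(x)`, (O2)/(O3) semicontinuity along the Hilbert–Samuel stratum; start value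
`O = 𝓑`, Lemma 4.7; transform rule (4.6)/(4.7) p. 57: `O'(x') = Õ(x) ∩ 𝓑'(x')` if `H_{X'}(x') = H_X(x)`, else RESET to `𝓑'(x')`; Lemma 4.13) and LABELS
(«years») of the irreducible components of the maximal `H`-locus, inherited along domination (p. 92, (6.5)) — data indexed by the POINTS and updated by
the local behaviour of `H_X` under each blow-up, which two runs reaching the same aged state `(S, Y, B)` need not share (the reset clause). So a `next`
reading only `(S, Y, B)` is not instantiated by CJS-as-printed, and an `IsoInvariant` selector on aged states could not be faithful to it (crit-3's v1
finding, one level finer). REPAIR (mechanical; every lemma of v3 re-proved below): the selector carries an ABSTRACT MEMO TYPE `Memo S` with `init`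
(start memo), `push` (update along one blow-up step with its centre) and `transport` (along isomorphisms of the ambient scheme); `next` reads
`(S, Y, B, μ)`; `Run` threads `μ' = push τ₁ Y B D μ`; `Resolves` starts from `init S Y`; an upstairs stage of `ShadowReach` now CARRIES a presentation
`(X₀, j, t)` of its special fibre and the DOWNSTAIRS memo `μ : Memo X₀`, and a step records the induced downstairs morphism `ρ : X₂₀ ⟶ X₀` — required to
be the blow-up of the selected `D` (crit-2 F2: this is the tree's `IsBlowup.of_isPullback_of_flat_exceptional`, see `ShadowReach.step_pullback`, proved,
modulo the ONE flatness lemma `exceptional_flat`) — and pushes the memo along `ρ`; `IsoInvariant` acquires the memo-transport clauses. The age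
list stays: it is what `WellShaped` and the age-0 class `clsR1` read; CJS's `(O, labels)` is one intended instance of `Memo`.
(T-b) — a greedy served-class process terminates — is NOT claimed anywhere in this file. -/

/-- A **selector**: a deterministic resolution strategy DOWNSTAIRS on AGED states WITH MEMO (v4). State = an ambient scheme `S` (a special fibre /
its transforms), the trace `Y ⊆ S` of the strict transform, the boundary `B : List (Set S)` = the exceptional traces ordered by AGE, head = youngest,
and a MEMO `μ : Memo S` — whatever the strategy remembers beyond the aged state (for CJS: the history function `O(x) ⊆ 𝓑(x)` of LNM 2270 Def. 4.6 and
the labels of (6.5)); `next S Y B μ = some D` selects the next centre (an ideal sheaf on `S`), `none` stops. The memo is INITIALISED by `init`, UPDATED by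
`push ρ Y B D` along the blow-up `ρ` of the centre `D` selected in state `(S, Y, B, μ)` (CJS: (4.6)/(4.7) and label inheritance), and TRANSPORTED along
isomorphisms by `transport`.
`Memo := fun _ => PUnit` (with the forced `init`/`push`/`transport`) recovers the memoryless v2/v3 interface, so v4 generalises v3.
[OURS · interface; instantiated by nothing in the tree yet — see `CJSSelectorExists`] -/
structure Selector : Type 1 where
  /-- the memo type on a downstairs ambient scheme. -/
  Memo : Scheme.{0} → Type
  /-- the memo of a START state `(S, Y, [])` (CJS: `O = 𝓑 = ∅`, all labels `0`). -/
  init : ∀ S : Scheme.{0}, Set S → Memo S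
  /-- the memo update along one step: `push ρ Y B D μ` = the memo on `S'` after blowing up the centre `D` selected in the state `(S, Y, B, μ)`,
  `ρ : S' ⟶ S` the blow-up (the new trace and boundary are determined by these data; CJS: (4.6)/(4.7) and label inheritance). -/
  push : ∀ {S S' : Scheme.{0}}, (S' ⟶ S) → Set S → List (Set S) → S.IdealSheafData → Memo S → Memo S'
  /-- memo transport along an isomorphism of ambient schemes (pull back along `e.hom : S₁ ⟶ S₂`). -/
  transport : ∀ {S₁ S₂ : Scheme.{0}}, (S₁ ≅ S₂) → Memo S₂ → Memo S₁
  /-- the next centre, read off the aged state AND the memo, or `none` (stop). -/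
  next : ∀ S : Scheme.{0}, Set S → List (Set S) → Memo S → Option S.IdealSheafData

namespace Selector

variable (sel : Selector)

/-- **Well-shaped**: a selected centre is a regular closed subscheme supported inside the strict-transform trace, at points which are NOT generic
points of (the closure of) the trace and which are boundary points (of SOME age: `⋃ B`) or singular points of the reduced closure of the trace —
whatever the memo. -/
def WellShaped : Prop :=
  ∀ (S : Scheme.{0}) (Y : Set S) (B : List (Set S)) (μ : sel.Memo S) (D : S.IdealSheafData), sel.next S Y B μ = some D →
    Literature.AlgebraicGeometry.Resolution.Scheme.IsRegular D.subscheme ∧ (D.support : Set S) ⊆ closure Y ∧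
    ∀ y ∈ (D.support : Set S), ¬ IsGenericPoint y (closure Y) ∧
      ((∃ E ∈ B, y ∈ E) ∨ ∃ v : redSub S (closure Y) isClosed_closure, redSubι S (closure Y) isClosed_closure v = y ∧
        ¬ IsRegularLocalRing ((redSub S (closure Y) isClosed_closure).presheaf.stalk v))

/-- **Iso-invariance** (functoriality of the strategy for isomorphisms of AGED MEMO states — the typed shadow of «canonical»), v4 = three clauses:
(next) transporting a state along an isomorphism `e : S₁ ≅ S₂` of the AMBIENT scheme (trace and every boundary entry pulled back, ages kept, memo
transported) transports the selected centre; (init) transport takes start memo to start memo; (push) transport commutes with the memo update along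
ISOMORPHIC steps (`e' ≫ ρ₂ = ρ₁ ≫ e`, state and centre pulled back). This is all the shape's proof route needs (comparison isomorphisms between an abstract
downstairs run and the special fibres of the upstairs chain, propagated step by step). NOT asked (crit-2 TRIAGE-r3-2 (3)): invariance under localisation /
étale or smooth morphisms, which the CJS strategy also enjoys — the constructor of `CJSSelectorExists` is not over-asked; for CJS's memo (functions of
points and of components) all three clauses are precomposition with the homeomorphism `e.hom`. -/
def IsoInvariant : Prop :=
  (∀ (S₁ S₂ : Scheme.{0}) (e : S₁ ≅ S₂) (Y : Set S₂) (B : List (Set S₂)) (μ : sel.Memo S₂),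
      sel.next S₁ (e.hom ⁻¹' Y) (B.map fun E => e.hom ⁻¹' E) (sel.transport e μ) = (sel.next S₂ Y B μ).map fun D => D.comap e.hom) ∧
  (∀ (S₁ S₂ : Scheme.{0}) (e : S₁ ≅ S₂) (Y : Set S₂), sel.transport e (sel.init S₂ Y) = sel.init S₁ (e.hom ⁻¹' Y)) ∧
  (∀ (S₁ S₂ S₁' S₂' : Scheme.{0}) (e : S₁ ≅ S₂) (e' : S₁' ≅ S₂') (ρ₁ : S₁' ⟶ S₁) (ρ₂ : S₂' ⟶ S₂) (Y : Set S₂) (B : List (Set S₂))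
      (D : S₂.IdealSheafData) (μ : sel.Memo S₂), e'.hom ≫ ρ₂ = ρ₁ ≫ e.hom →
      sel.transport e' (sel.push ρ₂ Y B D μ) = sel.push ρ₁ (e.hom ⁻¹' Y) (B.map fun E => e.hom ⁻¹' E) (D.comap e.hom) (sel.transport e μ))

/-- **S-G4 as a LEMMA (desk DESK WORDS 08:52:20Z (4): «state it as a lemma target»; proved): for an iso-invariant selector, at a START state
`(S, Y, [], init S Y)` the selected next centre is transported to itself by every automorphism `e` of `S` preserving `Y`.**  This is the clause a
`Classical.choice` inhabitant of a bare existence theorem cannot meet on a symmetric `(S, Y)` and the CJS constructor meets by canonicity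
(LNM 2270 Thm. 6.9 (F1) / Prop. 6.31) — the non-vacuity test of `CJSSelectorExists` (crit-3 TRIAGE-r7-3 evidence 2 = crit-2 TRIAGE-r7-2 S-G4). -/
theorem IsoInvariant.next_start_map_comap (hiso : sel.IsoInvariant) (S : Scheme.{0}) (Y : Set S) (e : S ≅ S) (he : e.hom ⁻¹' Y = Y) :
    (sel.next S Y [] (sel.init S Y)).map (fun D => D.comap e.hom) = sel.next S Y [] (sel.init S Y) := by
  obtain ⟨hnext, hinit, -⟩ := hiso
  have h1 := hnext S S e Y [] (sel.init S Y)
  rw [hinit S S e Y, he] at h1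
  simpa using h1.symm

/-- **The FIRST CENTRE of an iso-invariant selector is `Aut(S, Y)`-invariant** (S-G4, proved): if `next S Y [] (init S Y) = some D` then
`D.comap e.hom = D` for every automorphism `e` of `S` with `e.hom ⁻¹' Y = Y`.  (Inductively the same holds along the whole run, transporting trace,
aged boundary and memo; only the start case is recorded here.) -/
theorem IsoInvariant.comap_eq_of_next_start (hiso : sel.IsoInvariant) {S : Scheme.{0}} {Y : Set S} {D : S.IdealSheafData}
    (hD : sel.next S Y [] (sel.init S Y) = some D) (e : S ≅ S) (he : e.hom ⁻¹' Y = Y) : D.comap e.hom = D := by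
  have h := IsoInvariant.next_start_map_comap sel hiso S Y e he
  rw [hD] at h
  simpa using h

/-- The REDUCED ideal sheaf of the closure of a set of points (used to read an aged boundary entry `E : Set S` — in a run: the preimage of the support
of an earlier centre, closed — as the reduced closed subscheme CJS's Def. 5.2 speaks about). -/
def redIdeal (S : Scheme.{0}) (E : Set S) : S.IdealSheafData :=
  Scheme.IdealSheafData.vanishingIdeal ⟨closure E, isClosed_closure⟩

/-- **`𝓑`-permissibility of the selected centres** (v5; crit-3 TRIAGE-r7-3 sharpen (a): «whatever CJS behaviour a row consumes beyond `WellShaped` must be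
a NAMED conjunct of the slot … recommend the first such conjunct be `BPermissible sel`»).  Every centre the selector picks is NORMAL CROSSING WITH THE AGED
BOUNDARY at every point of its support, in the tree's typing of CJS Def. 5.2: `Literature.AlgebraicGeometry.Resolution.IsNormalCrossingWithBoundaryAt D 𝓑 x`
with `𝓑 = ` the list of reduced ideals of the boundary entries (ages = list order kept).  [cite: CossartJannsenSaito2020, Def. 5.2 (LNM 2270 p. 67 L15–23),
Def. 5.4 (p. 68 L3: `𝓑`-permissible = permissible + n.c. with `𝓑`); Lemma 4.2 (p. 53) «no boundary component lost»].  The other half of Def. 5.4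
(`D` permissible for the singular TRACE: `D ⊆ Σ^{max}` / normal flatness of `Y` along `D`) is deliberately NOT in this conjunct — it is a different row's
currency (Hilbert–Samuel strata) and would be a further named conjunct if a row consumes it.  ON THE INTENDED INHABITANT (v9; the v5–v7 sentence
«CJS centres are 𝓑-permissible by construction» is RETRACTED AS IT STOOD — crit-3 TRIAGE-r9-3 F-B / crit-2 TRIAGE-r9-2 S-G7): the conjunct compares with
CJS only because, SINCE v8, `Run.step` / `ShadowReach` / the `Serves*` continuations carry the older entries by STRICT transform
`closure (τ₁⁻¹ (E ∖ V(D)))` and add the new exceptional divisor as a separate (youngest) entry — the transport of CJS's complete transform of the boundary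
[LNM 2270 (5.2) p. 68, Def. 5.5 p. 69, Def. 5.7 p. 70: `𝓑′ = {B′₁, …, B′ₙ, E}`].  Under the v4–v7 TOTAL-preimage transport the conjunct was INCOMPARABLE with
CJS n.c.: a false ACCEPT (crit-2: parameters (u,v,w), `E_new = {u=0}`, old entry `{uv=0} ⊇ E_new` dropped from the test, `Z = V(u, v−w²)` tangent to the
double curve passes while Def. 4.1 rejects) and a false REJECT (crit-3: `E_new` duplicated off `St(E_old)`, CJS's own third centre `L̃₁ ⊔ L̃₂` on
`H = V(x³w + y²z²)`, char ≥ 5, fails the label-pair clause `0 + 2 ≠ 1`).  With the strict-transform transport the aged list IS CJS's boundary as a family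
of reduced divisors (ages = list positions), so the claim to check on the constructor is: the CJS canonical sequence is `𝓑`-permissible for THIS `𝓑`
(Thm. 1.4 / §5, Def. 5.4) — a statement about the inhabitant that lead-2's slot (b) must DISCHARGE, not a fact this file asserts.  MEMO GUARD (v10,
crit-3 TRIAGE-r10-3 S-G10): this conjunct reads the LIST `B`, not the memo — an inhabitant that tracks the boundary in its memo must still be n.c. with the
list as transported by `Run.step` (strict transforms + youngest exceptional), which since v8 is CJS's own `𝓑′`. -/
def BPermissible : Prop :=
  ∀ (S : Scheme.{0}) (Y : Set S) (B : List (Set S)) (μ : sel.Memo S) (D : S.IdealSheafData), sel.next S Y B μ = some D →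
    ∀ x ∈ (D.support : Set S), Literature.AlgebraicGeometry.Resolution.IsNormalCrossingWithBoundaryAt D (B.map (redIdeal S)) x

/-- **Runs** of the selector: `Run sel S Y B μ S' τ Y' B' μ'` — finitely many blow-ups, each in the centre `sel` selects, ending when `sel` stops;
`Y' = ` iterated closure-of-preimage strict-transform trace, `B' = ` the AGED boundary (each step PUSHES the new exceptional trace `τ₁⁻¹ V(D)` as the
youngest entry and replaces every older entry `E` by its STRICT TRANSFORM `closure (τ₁⁻¹ (E ∖ V(D)))` — v8, crit-2 TRIAGE-r9-2 S-G7: CJS transforms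
boundary members by strict transform and adds the new exceptional divisor separately [LNM 2270 Def. 5.5 p. 69, Def. 5.7 p. 70, Rem. 5.6 (b); p. 53 `𝓑′ = 𝓑̃ ∪ E`];
the v4–v7 TOTAL preimage `τ₁⁻¹ E ⊇ E_new` made `BPermissible` blind (Def. 5.2 drops members containing the centre); `⋃ B'`, the head and `WellShaped` are
unchanged in meaning since `τ₁⁻¹ E = St(E) ∪ (τ₁⁻¹ E ∩ E_new)`), `μ' = ` the memo pushed along every step. -/
inductive Run (sel : Selector) :
    ∀ (S : Scheme.{0}) (_Y : Set S) (_B : List (Set S)) (_μ : sel.Memo S) (S' : Scheme.{0}) (_τ : S' ⟶ S) (_Y' : Set S') (_B' : List (Set S'))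
      (_μ' : sel.Memo S'), Prop
  | stop {S : Scheme.{0}} {Y : Set S} {B : List (Set S)} {μ : sel.Memo S} (h : sel.next S Y B μ = none) : Run sel S Y B μ S (𝟙 S) Y B μ
  | step {S S₁ S' : Scheme.{0}} {Y : Set S} {B : List (Set S)} {μ : sel.Memo S} {D : S.IdealSheafData} (h : sel.next S Y B μ = some D)
      (τ₁ : S₁ ⟶ S) (hτ₁ : IsBlowup τ₁ D) {τ' : S' ⟶ S₁} {Y' : Set S'} {B' : List (Set S')} {μ' : sel.Memo S'}
      (hrest : Run sel S₁ (closure (τ₁ ⁻¹' (Y \ (D.support : Set S))))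
        ((τ₁ ⁻¹' (D.support : Set S)) :: B.map fun E => closure (τ₁ ⁻¹' (E \ (D.support : Set S)))) (sel.push τ₁ Y B D μ) S' τ' Y' B' μ') :
      Run sel S Y B μ S' (τ' ≫ τ₁) Y' B' μ'

/-- **Resolves surfaces over `k`**: from every start `(S, Y, [], init S Y)` — `S` regular and proper over `k`, `Y ⊆ S` closed irreducible of dimension
`≤ 2`, EMPTY boundary, START memo — the selector has a run that STOPS, and where it stops the reduced closure of the trace is regular (embedded
resolution reached). Generality note (crit-3 TRIAGE-r3-3): the ambient dimension of `S` is not bounded and `k` is any field; the candidate inhabitant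
[Cossart–Jannsen–Saito 2020, Thm 1.4] is stated for reduced excellent schemes of dimension ≤ 2 embedded in regular excellent schemes with boundary, of
any dimension — so the slot is not over-asked on that count; `S` of finite type over a field is excellent. -/
def Resolves (k : Type) [Field k] : Prop :=
  ∀ (S : Scheme.{0}) (f : S ⟶ Spec (.of k)) (Y : Set S),
    Literature.AlgebraicGeometry.Resolution.Scheme.IsRegular S → IsProper f → IsClosed Y → IsIrreducible Y →
    topologicalKrullDim Y ≤ 2 →
    ∃ (S' : Scheme.{0}) (τ : S' ⟶ S) (Y' : Set S') (B' : List (Set S')) (μ' : sel.Memo S'), sel.Run S Y [] (sel.init S Y) S' τ Y' B' μ' ∧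
      Literature.AlgebraicGeometry.Resolution.Scheme.IsRegular (redSub S' (closure Y') isClosed_closure)

/-- **Stage predicates** (v4): predicates of UPSTAIRS stages `(X', σ' : X' ⟶ P, Y', B')` TOGETHER WITH a presentation `(X₀, j : X₀ ⟶ X', t : X₀ ⟶ Spec k)`
of the special fibre, the DOWNSTAIRS aged boundary `B₀ : List (Set X₀)` (v10, crit-3 TRIAGE-r10-3 F-C / repair C1: CARRIED, not derived from `B'`) and the
DOWNSTAIRS memo `μ : Memo X₀` that the shadowed strategy holds there. -/
abbrev StagePred (k : Type) [CommRing k] (P : Scheme.{0}) : Type 1 :=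
  ∀ X' : Scheme.{0}, (X' ⟶ P) → Set X' → List (Set X') → ∀ X₀ : Scheme.{0}, (X₀ ⟶ X') → (X₀ ⟶ Spec (.of k)) → List (Set X₀) → sel.Memo X₀ → Prop

/-- **Shadow-reachable upstairs stages** over `(O ↠ k)`: impredicative closure, as in the crux text. A stage is `(X', σ' : X' ⟶ P, Y', B')` with
`B' : List (Set X')` AGED, together with (v4) a PRESENTATION `(X₀, j, t)` of the special fibre of `X'` (a model square over `θ`) and the downstairs MEMO
`μ : Memo X₀` and (v10) the downstairs aged boundary `B₁₀`. Root: `P` itself with ANY presentation of its special fibre, EMPTY boundaries and the start memo.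
Step: read the centre `D = sel.next X₀ (j⁻¹ Y₁) B₁₀ μ₁` the selector picks DOWNSTAIRS on the CARRIED boundary `B₁₀` — v10, crit-3 TRIAGE-r10-3 F-C /
repair C1: the downstairs list is transported by `Run.step`'s OWN recipe along the induced `ρ` (`ρ⁻¹ V(D)` pushed in front of the strict transforms
`closure (ρ⁻¹ (E ∖ V(D)))`), so every shadow stage's downstairs state is `Run`-reachable BY CONSTRUCTION; it is NOT derived as `B'.map (j ⁻¹' ·)` from the
upstairs list (exact for the trace, which lives in the special fibre, and for the head entry — `ShadowReach.head?_eq` — but NOT for the strict transform of an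
OLDER entry when the lift `C` meets it non-flatly over `O`: F-C witness `C = (ϖ^m, 0, 0)`, `E = {a = 0}`, `St(E) ⊇ F_k`); the upstairs list `B'` is kept for
the hosts (§D). The selector picks DOWNSTAIRS, take ANY regular `O`-flat lift `C` of `D` (`C.comap j₁ = D`), blow `C` up
(`τ`; new trace = closure of the preimage of `Y₁ ∖ V(C)`, new boundary = `τ⁻¹ V(C)` PUSHED in front of the STRICT TRANSFORMS `closure (τ⁻¹ (E ∖ V(C)))` of the old entries — v8, S-G7), take ANY presentation
`(X₂₀, j₂, t₂)` of the new special fibre together with the induced downstairs morphism `ρ : X₂₀ ⟶ X₀` (`ρ ≫ j₁ = j₂ ≫ τ`) REQUIRED to be the blow-up of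
`D` (F2), and push the memo along `ρ`. The presentation is part of the stage because the memo lives downstairs.
v5 note (crit-3 TRIAGE-r7-3 (b)): the step does NOT record `ρ ≫ t₁ = t₂`; this is automatic when `θ` is surjective (`Spec k → Spec O` is then a
monomorphism — the only case `SupplementWith` instantiates) and a harmless widening of the reachable family otherwise; a prover of `stub_R1a` in its
stated generality must therefore not assume that the continuation square is the chosen fibre product (the route via `IsBlowup ρ D` + regularity of `D`
and of `X₀` does not need it). -/
def ShadowReach {O : Type} [CommRing O] {k : Type} [CommRing k] (θ : O →+* k)
    (P : Scheme.{0}) (g : P ⟶ Spec (.of O)) (Y : Set P)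
    (X' : Scheme.{0}) (σ' : X' ⟶ P) (Y' : Set X') (B' : List (Set X'))
    (X₀ : Scheme.{0}) (j : X₀ ⟶ X') (t : X₀ ⟶ Spec (.of k)) (B₀ : List (Set X₀)) (μ : sel.Memo X₀) : Prop :=
  ∀ Q : sel.StagePred k P,
    (∀ (P₀ : Scheme.{0}) (j₀ : P₀ ⟶ P) (t₀ : P₀ ⟶ Spec (.of k)),
        IsPullback j₀ t₀ g (Spec.map (CommRingCat.ofHom θ)) → Q P (𝟙 P) Y [] P₀ j₀ t₀ [] (sel.init P₀ (j₀ ⁻¹' Y))) →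
    (∀ (X₁ X₂ X₁₀ X₂₀ : Scheme.{0}) (σ₁ : X₁ ⟶ P) (Y₁ : Set X₁) (B₁ : List (Set X₁)) (j₁ : X₁₀ ⟶ X₁) (t₁ : X₁₀ ⟶ Spec (.of k))
        (B₁₀ : List (Set X₁₀)) (μ₁ : sel.Memo X₁₀) (D : X₁₀.IdealSheafData) (C : X₁.IdealSheafData) (τ : X₂ ⟶ X₁)
        (j₂ : X₂₀ ⟶ X₂) (t₂ : X₂₀ ⟶ Spec (.of k)) (ρ : X₂₀ ⟶ X₁₀),
        Q X₁ σ₁ Y₁ B₁ X₁₀ j₁ t₁ B₁₀ μ₁ →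
        sel.next X₁₀ (j₁ ⁻¹' Y₁) B₁₀ μ₁ = some D →
        Literature.AlgebraicGeometry.Resolution.Scheme.IsRegular C.subscheme → Flat (C.subschemeι ≫ σ₁ ≫ g) → C.comap j₁ = D →
        IsBlowup τ C →
        IsPullback j₂ t₂ ((τ ≫ σ₁) ≫ g) (Spec.map (CommRingCat.ofHom θ)) → ρ ≫ j₁ = j₂ ≫ τ → IsBlowup ρ D →
        Q X₂ (τ ≫ σ₁) (closure (τ ⁻¹' (Y₁ \ (C.support : Set X₁)))) ((τ ⁻¹' (C.support : Set X₁)) :: B₁.map fun E => closure (τ ⁻¹' (E \ (C.support : Set X₁))))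
          X₂₀ j₂ t₂
          ((ρ ⁻¹' (D.support : Set X₁₀)) :: B₁₀.map fun E => closure (ρ ⁻¹' (E \ (D.support : Set X₁₀)))) (sel.push ρ (j₁ ⁻¹' Y₁) B₁₀ D μ₁)) →
    Q X' σ' Y' B' X₀ j t B₀ μ

/-- The root stage, with any presentation of its special fibre and the start memo, is shadow-reachable (proved). -/
theorem ShadowReach.root {sel : Selector} {O : Type} [CommRing O] {k : Type} [CommRing k] {θ : O →+* k}
    {P : Scheme.{0}} {g : P ⟶ Spec (.of O)} {Y : Set P} {P₀ : Scheme.{0}} {j₀ : P₀ ⟶ P} {t₀ : P₀ ⟶ Spec (.of k)}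
    (hp₀ : IsPullback j₀ t₀ g (Spec.map (CommRingCat.ofHom θ))) : sel.ShadowReach θ P g Y P (𝟙 P) Y [] P₀ j₀ t₀ [] (sel.init P₀ (j₀ ⁻¹' Y)) :=
  fun _ hroot _ => hroot P₀ j₀ t₀ hp₀

/-- Shadow-reachability is preserved by a shadowed step with ANY regular `O`-flat lift of the selected centre, any presentation of the new special fibre
and the induced downstairs blow-up (proved). -/
theorem ShadowReach.step {sel : Selector} {O : Type} [CommRing O] {k : Type} [CommRing k] {θ : O →+* k}
    {P : Scheme.{0}} {g : P ⟶ Spec (.of O)} {Y : Set P}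
    {X₁ X₂ X₁₀ X₂₀ : Scheme.{0}} {σ₁ : X₁ ⟶ P} {Y₁ : Set X₁} {B₁ : List (Set X₁)} {j₁ : X₁₀ ⟶ X₁} {t₁ : X₁₀ ⟶ Spec (.of k)}
    {B₁₀ : List (Set X₁₀)} {μ₁ : sel.Memo X₁₀} {D : X₁₀.IdealSheafData} {C : X₁.IdealSheafData} {τ : X₂ ⟶ X₁}
    {j₂ : X₂₀ ⟶ X₂} {t₂ : X₂₀ ⟶ Spec (.of k)} {ρ : X₂₀ ⟶ X₁₀}
    (hG : sel.ShadowReach θ P g Y X₁ σ₁ Y₁ B₁ X₁₀ j₁ t₁ B₁₀ μ₁)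
    (hD : sel.next X₁₀ (j₁ ⁻¹' Y₁) B₁₀ μ₁ = some D)
    (hreg : Literature.AlgebraicGeometry.Resolution.Scheme.IsRegular C.subscheme) (hfl : Flat (C.subschemeι ≫ σ₁ ≫ g))
    (hcomap : C.comap j₁ = D) (hτ : IsBlowup τ C)
    (hp₂ : IsPullback j₂ t₂ ((τ ≫ σ₁) ≫ g) (Spec.map (CommRingCat.ofHom θ))) (hρ : ρ ≫ j₁ = j₂ ≫ τ) (hρD : IsBlowup ρ D) :
    sel.ShadowReach θ P g Y X₂ (τ ≫ σ₁) (closure (τ ⁻¹' (Y₁ \ (C.support : Set X₁))))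
      ((τ ⁻¹' (C.support : Set X₁)) :: B₁.map fun E => closure (τ ⁻¹' (E \ (C.support : Set X₁)))) X₂₀ j₂ t₂
          ((ρ ⁻¹' (D.support : Set X₁₀)) :: B₁₀.map fun E => closure (ρ ⁻¹' (E \ (D.support : Set X₁₀)))) (sel.push ρ (j₁ ⁻¹' Y₁) B₁₀ D μ₁) :=
  fun Q hroot hstep => hstep X₁ X₂ X₁₀ X₂₀ σ₁ Y₁ B₁ j₁ t₁ B₁₀ μ₁ D C τ j₂ t₂ ρ (hG Q hroot hstep) hD hreg hfl hcomap hτ hp₂ hρ hρD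

/-- At a shadow-reachable stage the carried presentation IS a model square of the special fibre (proved by induction along the closure). -/
theorem ShadowReach.isPullback {sel : Selector} {O : Type} [CommRing O] {k : Type} [CommRing k] {θ : O →+* k}
    {P : Scheme.{0}} {g : P ⟶ Spec (.of O)} {Y : Set P}
    {X' X₀ : Scheme.{0}} {σ' : X' ⟶ P} {Y' : Set X'} {B' : List (Set X')} {j : X₀ ⟶ X'} {t : X₀ ⟶ Spec (.of k)} {B₀ : List (Set X₀)} {μ : sel.Memo X₀}
    (hG : sel.ShadowReach θ P g Y X' σ' Y' B' X₀ j t B₀ μ) : IsPullback j t (σ' ≫ g) (Spec.map (CommRingCat.ofHom θ)) :=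
  hG (fun X₁ σ₁ _ _ X₁₀ j₁ t₁ _ _ => IsPullback j₁ t₁ (σ₁ ≫ g) (Spec.map (CommRingCat.ofHom θ)))
    (fun _ _ _ hp₀ => by simpa only [Category.id_comp] using hp₀)
    (fun _ _ _ _ _ _ _ _ _ _ _ _ _ _ _ _ _ _ _ _ _ _ _ hp₂ _ _ => hp₂)

/-- **Head exactness (v10, proved)**: at a shadow-reachable stage the youngest DOWNSTAIRS entry is the special fibre of the youngest UPSTAIRS entry —
`B₀.head? = (B'.map (j ⁻¹' ·)).head?` (both empty at the root; at a step `ρ⁻¹ V(D) = j₂⁻¹ τ⁻¹ V(C)` from `C.comap j₁ = D` and `ρ ≫ j₁ = j₂ ≫ τ`).  This is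
the part of the old derived reading that IS exact; the age ≥ 1 entries are where it was not (crit-3 F-C). Used by `servesNextOn_R1`. -/
theorem ShadowReach.head?_eq {sel : Selector} {O : Type} [CommRing O] {k : Type} [CommRing k] {θ : O →+* k}
    {P : Scheme.{0}} {g : P ⟶ Spec (.of O)} {Y : Set P}
    {X' X₀ : Scheme.{0}} {σ' : X' ⟶ P} {Y' : Set X'} {B' : List (Set X')} {j : X₀ ⟶ X'} {t : X₀ ⟶ Spec (.of k)} {B₀ : List (Set X₀)} {μ : sel.Memo X₀}
    (hG : sel.ShadowReach θ P g Y X' σ' Y' B' X₀ j t B₀ μ) : B₀.head? = (B'.map fun E => j ⁻¹' E).head? := by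
  refine hG (fun X₁ _ _ B₁ X₁₀ j₁ _ B₁₀ _ => B₁₀.head? = (B₁.map fun E => j₁ ⁻¹' E).head?) (fun _ _ _ _ => rfl) ?_
  intro X₁ X₂ X₁₀ X₂₀ σ₁ Y₁ B₁ j₁ t₁ B₁₀ μ₁ D C τ j₂ t₂ ρ _ _ _ _ hCD _ _ hcomm _
  have hx : ∀ x : X₂₀, j₁ (ρ x) = τ (j₂ x) := fun x => by
    rw [← Scheme.Hom.comp_apply, hcomm, Scheme.Hom.comp_apply]
  have hsupp : ∀ y : X₁₀, y ∈ (D.support : Set X₁₀) ↔ j₁ y ∈ (C.support : Set X₁) := fun y => by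
    rw [← hCD, Scheme.IdealSheafData.support_comap]; rfl
  simp only [List.map_cons, List.head?_cons, Option.some.injEq]
  ext x
  simp only [Set.mem_preimage]
  rw [hsupp, hx]

/-! ### Trace exactness (v11; crit-2 TRIAGE-r13-2 S-G11 / crit-3 TRIAGE-r12-3 S-G11 — proved)

The downstairs TRACE stays DERIVED as `j ⁻¹' Y'` ON PURPOSE (it is not a second carried datum): unlike the strict transform of an older boundary entry
(F-C), it IS exact.  Kernel facts: traces stay over the image of `Spec k` (`ShadowReach.trace_subset`, for `Y` over that image and the image closed —
e.g. `θ` surjective onto a field), hence inside the range of every carried presentation (`trace_subset_range`); and ONE-STEP EXACTNESS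
(`trace_step_eq` / `ShadowReach.trace_step_exact`): when the new presentation `j₂` is a closed immersion (automatic for `θ` surjective: base change of
the closed immersion `Spec k → Spec O`), `j₂ ⁻¹' closure (τ ⁻¹' (Y₁ ∖ V(C))) = closure (ρ ⁻¹' ((j₁ ⁻¹' Y₁) ∖ V(D)))` — `Run.step`'s trace recipe along `ρ`
— because an embedding commutes `closure` with preimage on subsets of its range and `V(D) = j₁⁻¹ V(C)` (`support_comap`).  (crit-2 notes exactness for
any `θ` into a field via universal openness of `Spec k → Spec κ`; only the closed-immersion case is typed here.)  So after v10/v11 a shadow stage's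
downstairs triple (trace, boundary, memo) is `Run`-exact in all three components: trace by these lemmas, boundary and memo by construction. -/

/-- Points of the base lying over the image of `i` lift to the pullback (from `Scheme.exists_preimage_of_isPullback`). -/
theorem preimage_range_subset_range_of_isPullback {X₂ X₂₀ Z W : Scheme.{0}} {j₂ : X₂₀ ⟶ X₂} {t₂ : X₂₀ ⟶ W}
    {f : X₂ ⟶ Z} {i : W ⟶ Z} (hp : IsPullback j₂ t₂ f i) : f ⁻¹' Set.range i ⊆ Set.range j₂ := by
  rintro x ⟨w, hw⟩
  obtain ⟨p, hp1, -⟩ := Scheme.exists_preimage_of_isPullback hp x w hw.symm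
  exact ⟨p, hp1⟩

/-- **One-step trace exactness (pure plumbing, proved).** For a commuting square `ρ ≫ j₁ = j₂ ≫ τ` with `j₂` a closed immersion, `τ ⁻¹' Y₁` inside the
range of `j₂`, and `D = C.comap j₁`: restricting the upstairs strict-transform trace along `j₂` gives the downstairs strict-transform trace along `ρ`. -/
theorem trace_step_eq {X₁ X₂ X₁₀ X₂₀ : Scheme.{0}} {j₁ : X₁₀ ⟶ X₁} {τ : X₂ ⟶ X₁} {j₂ : X₂₀ ⟶ X₂} {ρ : X₂₀ ⟶ X₁₀}
    [IsClosedImmersion j₂] (hcomm : ρ ≫ j₁ = j₂ ≫ τ) {Y₁ : Set X₁} (hY₁ : τ ⁻¹' Y₁ ⊆ Set.range j₂)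
    {C : X₁.IdealSheafData} {D : X₁₀.IdealSheafData} (hCD : C.comap j₁ = D) :
    j₂ ⁻¹' closure (τ ⁻¹' (Y₁ \ (C.support : Set X₁))) = closure (ρ ⁻¹' ((j₁ ⁻¹' Y₁) \ (D.support : Set X₁₀))) := by
  have hx : ∀ x : X₂₀, j₁ (ρ x) = τ (j₂ x) := fun x => by
    rw [← Scheme.Hom.comp_apply, hcomm, Scheme.Hom.comp_apply]
  have hsupp : ∀ y : X₁₀, y ∈ (D.support : Set X₁₀) ↔ j₁ y ∈ (C.support : Set X₁) := fun y => by
    rw [← hCD, Scheme.IdealSheafData.support_comap]; rfl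
  have hA : j₂ ⁻¹' (τ ⁻¹' (Y₁ \ (C.support : Set X₁))) = ρ ⁻¹' ((j₁ ⁻¹' Y₁) \ (D.support : Set X₁₀)) := by
    ext x
    simp only [Set.mem_preimage, Set.mem_sdiff]
    rw [hsupp, hx]
  have hsub : τ ⁻¹' (Y₁ \ (C.support : Set X₁)) ⊆ Set.range j₂ := fun x hx' => hY₁ hx'.1
  rw [← hA, j₂.isClosedEmbedding.isEmbedding.closure_eq_preimage_closure_image (j₂ ⁻¹' (τ ⁻¹' (Y₁ \ (C.support : Set X₁)))),
    Set.image_preimage_eq_of_subset hsub]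

/-- **Traces stay over the image of `Spec k` (proved by induction along `ShadowReach`).** -/
theorem ShadowReach.trace_subset {sel : Selector} {O : Type} [CommRing O] {k : Type} [CommRing k] {θ : O →+* k}
    {P : Scheme.{0}} {g : P ⟶ Spec (.of O)} {Y : Set P}
    (hR : IsClosed (Set.range (Spec.map (CommRingCat.ofHom θ))))
    (hY : Y ⊆ g ⁻¹' Set.range (Spec.map (CommRingCat.ofHom θ)))
    {X' X₀ : Scheme.{0}} {σ' : X' ⟶ P} {Y' : Set X'} {B' : List (Set X')} {j : X₀ ⟶ X'} {t : X₀ ⟶ Spec (.of k)} {B₀ : List (Set X₀)}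
    {μ : sel.Memo X₀}
    (hG : sel.ShadowReach θ P g Y X' σ' Y' B' X₀ j t B₀ μ) : Y' ⊆ (σ' ≫ g) ⁻¹' Set.range (Spec.map (CommRingCat.ofHom θ)) := by
  refine hG (fun X₁ σ₁ Y₁ _ _ _ _ _ _ => Y₁ ⊆ (σ₁ ≫ g) ⁻¹' Set.range (Spec.map (CommRingCat.ofHom θ))) ?_ ?_
  · intro P₀ j₀ t₀ _
    simpa only [Category.id_comp] using hY
  · intro X₁ X₂ X₁₀ X₂₀ σ₁ Y₁ B₁ j₁ t₁ B₁₀ μ₁ D C τ j₂ t₂ ρ hY₁ _ _ _ _ _ _ _ _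
    refine closure_minimal ?_ (hR.preimage ((τ ≫ σ₁) ≫ g).continuous)
    intro x hx
    have h1 := hY₁ hx.1
    simpa only [Set.mem_preimage, Scheme.Hom.comp_apply] using h1

/-- Hence the trace lies inside the range of every carried presentation (proved). -/
theorem ShadowReach.trace_subset_range {sel : Selector} {O : Type} [CommRing O] {k : Type} [CommRing k] {θ : O →+* k}
    {P : Scheme.{0}} {g : P ⟶ Spec (.of O)} {Y : Set P}
    (hR : IsClosed (Set.range (Spec.map (CommRingCat.ofHom θ))))
    (hY : Y ⊆ g ⁻¹' Set.range (Spec.map (CommRingCat.ofHom θ)))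
    {X' X₀ : Scheme.{0}} {σ' : X' ⟶ P} {Y' : Set X'} {B' : List (Set X')} {j : X₀ ⟶ X'} {t : X₀ ⟶ Spec (.of k)} {B₀ : List (Set X₀)}
    {μ : sel.Memo X₀}
    (hG : sel.ShadowReach θ P g Y X' σ' Y' B' X₀ j t B₀ μ) : Y' ⊆ Set.range j :=
  (hG.trace_subset hR hY).trans (preimage_range_subset_range_of_isPullback hG.isPullback)

/-- **Trace exactness at a shadowed step (proved)**: with `Y` over the (closed) image of `Spec k` and the new presentation `j₂` a closed immersion, the
derived downstairs trace of the continuation IS `Run.step`'s trace along the induced `ρ`. -/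
theorem ShadowReach.trace_step_exact {sel : Selector} {O : Type} [CommRing O] {k : Type} [CommRing k] {θ : O →+* k}
    {P : Scheme.{0}} {g : P ⟶ Spec (.of O)} {Y : Set P}
    (hR : IsClosed (Set.range (Spec.map (CommRingCat.ofHom θ))))
    (hY : Y ⊆ g ⁻¹' Set.range (Spec.map (CommRingCat.ofHom θ)))
    {X₁ X₂ X₁₀ X₂₀ : Scheme.{0}} {σ₁ : X₁ ⟶ P} {Y₁ : Set X₁} {B₁ : List (Set X₁)} {j₁ : X₁₀ ⟶ X₁} {t₁ : X₁₀ ⟶ Spec (.of k)}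
    {B₁₀ : List (Set X₁₀)} {μ₁ : sel.Memo X₁₀} {D : X₁₀.IdealSheafData} {C : X₁.IdealSheafData} {τ : X₂ ⟶ X₁}
    {j₂ : X₂₀ ⟶ X₂} {t₂ : X₂₀ ⟶ Spec (.of k)} {ρ : X₂₀ ⟶ X₁₀} [IsClosedImmersion j₂]
    (hG : sel.ShadowReach θ P g Y X₁ σ₁ Y₁ B₁ X₁₀ j₁ t₁ B₁₀ μ₁) (hCD : C.comap j₁ = D)
    (hp₂ : IsPullback j₂ t₂ ((τ ≫ σ₁) ≫ g) (Spec.map (CommRingCat.ofHom θ))) (hcomm : ρ ≫ j₁ = j₂ ≫ τ) :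
    j₂ ⁻¹' closure (τ ⁻¹' (Y₁ \ (C.support : Set X₁))) = closure (ρ ⁻¹' ((j₁ ⁻¹' Y₁) \ (D.support : Set X₁₀))) := by
  refine trace_step_eq hcomm ?_ hCD
  have h1 := hG.trace_subset hR hY
  refine Set.Subset.trans ?_ (preimage_range_subset_range_of_isPullback hp₂)
  intro x hx
  have h2 := h1 hx
  simpa only [Set.mem_preimage, Scheme.Hom.comp_apply] using h2

/-- `Spec k → Spec O` is a closed immersion for `θ` surjective (`IsClosedImmersion.spec_of_surjective`, restated for a bare ring hom). -/
theorem isClosedImmersion_specMap_of_surjective {O : Type} [CommRing O] {k : Type} [CommRing k] {θ : O →+* k}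
    (hθ : Function.Surjective θ) : IsClosedImmersion (Spec.map (CommRingCat.ofHom θ)) :=
  IsClosedImmersion.spec_of_surjective (CommRingCat.ofHom θ) fun y => by
    obtain ⟨x, hx⟩ := hθ y
    exact ⟨x, hx⟩

/-- **Every carried presentation is a closed immersion when `θ` is surjective (proved)** — a base change of the closed immersion `Spec k → Spec O`
(`IsClosedImmersion.isStableUnderBaseChange`).  This is the F-shape's situation (`θ = π : O ↠ k` the residue map). -/
theorem ShadowReach.isClosedImmersion_of_surjective {sel : Selector} {O : Type} [CommRing O] {k : Type} [CommRing k] {θ : O →+* k}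
    (hθ : Function.Surjective θ) {P : Scheme.{0}} {g : P ⟶ Spec (.of O)} {Y : Set P}
    {X' X₀ : Scheme.{0}} {σ' : X' ⟶ P} {Y' : Set X'} {B' : List (Set X')} {j : X₀ ⟶ X'} {t : X₀ ⟶ Spec (.of k)} {B₀ : List (Set X₀)}
    {μ : sel.Memo X₀}
    (hG : sel.ShadowReach θ P g Y X' σ' Y' B' X₀ j t B₀ μ) : IsClosedImmersion j :=
  IsClosedImmersion.isStableUnderBaseChange.of_isPullback hG.isPullback.flip (isClosedImmersion_specMap_of_surjective hθ)

/-- **Trace exactness in the F-shape's situation (proved; hypotheses discharged)**: for `θ` surjective the image of `Spec k` is closed and the new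
presentation `j₂` is a closed immersion, so `ShadowReach.trace_step_exact` needs only `Y` over that image (for `Y = range (ι ≫ Proj.map φ)`, the
special fibre of `ℙ³_O`, this is `g ⁻¹'` of the closed point). -/
theorem ShadowReach.trace_step_exact_of_surjective {sel : Selector} {O : Type} [CommRing O] {k : Type} [CommRing k] {θ : O →+* k}
    (hθ : Function.Surjective θ) {P : Scheme.{0}} {g : P ⟶ Spec (.of O)} {Y : Set P}
    (hY : Y ⊆ g ⁻¹' Set.range (Spec.map (CommRingCat.ofHom θ)))
    {X₁ X₂ X₁₀ X₂₀ : Scheme.{0}} {σ₁ : X₁ ⟶ P} {Y₁ : Set X₁} {B₁ : List (Set X₁)} {j₁ : X₁₀ ⟶ X₁} {t₁ : X₁₀ ⟶ Spec (.of k)}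
    {B₁₀ : List (Set X₁₀)} {μ₁ : sel.Memo X₁₀} {D : X₁₀.IdealSheafData} {C : X₁.IdealSheafData} {τ : X₂ ⟶ X₁}
    {j₂ : X₂₀ ⟶ X₂} {t₂ : X₂₀ ⟶ Spec (.of k)} {ρ : X₂₀ ⟶ X₁₀}
    (hG : sel.ShadowReach θ P g Y X₁ σ₁ Y₁ B₁ X₁₀ j₁ t₁ B₁₀ μ₁) (hCD : C.comap j₁ = D)
    (hp₂ : IsPullback j₂ t₂ ((τ ≫ σ₁) ≫ g) (Spec.map (CommRingCat.ofHom θ))) (hcomm : ρ ≫ j₁ = j₂ ≫ τ) :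
    j₂ ⁻¹' closure (τ ⁻¹' (Y₁ \ (C.support : Set X₁))) = closure (ρ ⁻¹' ((j₁ ⁻¹' Y₁) \ (D.support : Set X₁₀))) := by
  haveI hi : IsClosedImmersion (Spec.map (CommRingCat.ofHom θ)) := isClosedImmersion_specMap_of_surjective hθ
  have hR : IsClosed (Set.range (Spec.map (CommRingCat.ofHom θ))) :=
    (Spec.map (CommRingCat.ofHom θ)).isClosedEmbedding.isClosed_range
  haveI : IsClosedImmersion j₂ := IsClosedImmersion.isStableUnderBaseChange.of_isPullback hp₂.flip hi
  exact hG.trace_step_exact hR hY hCD hp₂ hcomm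

/-- **F2, typed and proved from the tree (crit-2 TRIAGE-r5-2 F2).** At a shadow-reachable stage, after blowing up ANY regular `O`-flat lift `C` of the
selected `D`, the fibre product `X₂ ×_{X₁} X₀` with its two projections presents the new special fibre, the induced `ρ : X₂ ×_{X₁} X₀ ⟶ X₀` IS the blow-up
of `D = C|_{X₀}` — by `Literature.AlgebraicGeometry.Resolution.IsBlowup.of_isPullback_of_flat_exceptional` (BlowupsRelativeCartier; blow-ups commute with
base change when the EXCEPTIONAL DIVISOR is flat over the base; for whole sequences: `CentreSeq.isPullback_comap_specMap_of_exceptionalFlatOver`,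
BlowupSequencesBaseChange) — and so the new stage is shadow-reachable. The ONE hypothesis beyond the stage data is `Flat (E_C ⟶ Spec O)` for the
exceptional divisor `E_C = V(C · 𝒪_{X₂})`, taken here as an instance argument and discharged in the regular regime by `exceptional_flat` below.
(NOT the flat-base-change lemma `IsBlowup.of_isPullback_of_flat` — `Spec k → Spec O` is not flat; that one serves the localisation square of
`GermClockDeltaSquare.lean`.) -/
theorem ShadowReach.step_pullback {sel : Selector} {O : Type} [CommRing O] {k : Type} [CommRing k] {θ : O →+* k}
    {P : Scheme.{0}} {g : P ⟶ Spec (.of O)} {Y : Set P}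
    {X₁ X₂ X₁₀ : Scheme.{0}} {σ₁ : X₁ ⟶ P} {Y₁ : Set X₁} {B₁ : List (Set X₁)} {j₁ : X₁₀ ⟶ X₁} {t₁ : X₁₀ ⟶ Spec (.of k)}
    {B₁₀ : List (Set X₁₀)} {μ₁ : sel.Memo X₁₀} {D : X₁₀.IdealSheafData} {C : X₁.IdealSheafData} {τ : X₂ ⟶ X₁}
    (hG : sel.ShadowReach θ P g Y X₁ σ₁ Y₁ B₁ X₁₀ j₁ t₁ B₁₀ μ₁)
    (hD : sel.next X₁₀ (j₁ ⁻¹' Y₁) B₁₀ μ₁ = some D)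
    (hreg : Literature.AlgebraicGeometry.Resolution.Scheme.IsRegular C.subscheme) (hfl : Flat (C.subschemeι ≫ σ₁ ≫ g))
    (hcomap : C.comap j₁ = D) (hτ : IsBlowup τ C) [Flat ((C.comap τ).subschemeι ≫ τ ≫ σ₁ ≫ g)] :
    sel.ShadowReach θ P g Y X₂ (τ ≫ σ₁) (closure (τ ⁻¹' (Y₁ \ (C.support : Set X₁))))
      ((τ ⁻¹' (C.support : Set X₁)) :: B₁.map fun E => closure (τ ⁻¹' (E \ (C.support : Set X₁))))
      (Limits.pullback τ j₁) (Limits.pullback.fst τ j₁) (Limits.pullback.snd τ j₁ ≫ t₁)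
      ((Limits.pullback.snd τ j₁ ⁻¹' (D.support : Set X₁₀)) :: B₁₀.map fun E => closure (Limits.pullback.snd τ j₁ ⁻¹' (E \ (D.support : Set X₁₀))))
      (sel.push (Limits.pullback.snd τ j₁) (j₁ ⁻¹' Y₁) B₁₀ D μ₁) := by
  have hp₁ := hG.isPullback
  have hsq : IsPullback (Limits.pullback.fst τ j₁) (Limits.pullback.snd τ j₁) τ j₁ := IsPullback.of_hasPullback τ j₁
  have hp₂ : IsPullback (Limits.pullback.fst τ j₁) (Limits.pullback.snd τ j₁ ≫ t₁) ((τ ≫ σ₁) ≫ g) (Spec.map (CommRingCat.ofHom θ)) := by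
    simpa only [Category.assoc] using hsq.paste_vert hp₁
  letI : Algebra O k := θ.toAlgebra
  have HX : IsPullback j₁ t₁ (σ₁ ≫ g) (Literature.AlgebraicGeometry.Resolution.specOfAlgebra O k) := by
    simpa only [Literature.AlgebraicGeometry.Resolution.specOfAlgebra, RingHom.algebraMap_toAlgebra] using hp₁
  have hρD : IsBlowup (Limits.pullback.snd τ j₁) D := by
    have h := hτ.of_isPullback_of_flat_exceptional k (σ₁ ≫ g) HX hsq
    rwa [hcomap] at h
  exact hG.step hD hreg hfl hcomap hτ hp₂ hsq.w.symm hρD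

/-- **(T-a) restricted to a class** `cls` of selected centres (`cls X₀ Y₀ B₀ D`, reading the AGED boundary `B₀`; classes are GEOMETRIC — they do not
read the memo): at every shadow-reachable upstairs stage (with its carried presentation and memo), IF the selector picks a centre `D` of class `cls` THEN
`D` has a regular `O`-flat lift `C` (`C.comap j = D`, `V(C) → Spec O` flat). ∀-form: no choice of earlier lifts is assumed favourable. AGE PRINCIPLE (v2,
heuristic, see §D / `clsR1`): what survives arbitrary earlier lifts is the age-0 datum, so a class reading only the youngest boundary entry is served in this
∀-form — R1 (§D, `servesNextOn_R1`); classes reading entries of age ≥ 1 (R2: fibres of an older ruling; R3/R3′: sections rigid on a prefix) are expected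
to need the FORESEE form `ServesAlongOn` of §C. Rows R4 (G2 multiplicity ≥ 2), R7 (G3 closed points), R8 (irrational directions) are the OPEN classes
of the card. -/
def ServesNextOn (cls : ∀ X₀ : Scheme.{0}, Set X₀ → List (Set X₀) → X₀.IdealSheafData → Prop)
    {O : Type} [CommRing O] {k : Type} [CommRing k] (θ : O →+* k)
    (P : Scheme.{0}) (g : P ⟶ Spec (.of O)) (Y : Set P) : Prop :=
  ∀ (X' X₀ : Scheme.{0}) (σ' : X' ⟶ P) (Y' : Set X') (B' : List (Set X')) (j : X₀ ⟶ X') (t : X₀ ⟶ Spec (.of k))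
    (B₀ : List (Set X₀)) (μ : sel.Memo X₀) (D : X₀.IdealSheafData),
    sel.ShadowReach θ P g Y X' σ' Y' B' X₀ j t B₀ μ →
    sel.next X₀ (j ⁻¹' Y') B₀ μ = some D → cls X₀ (j ⁻¹' Y') B₀ D →
    ∃ C : X'.IdealSheafData, Literature.AlgebraicGeometry.Resolution.Scheme.IsRegular C.subscheme ∧
      Flat (C.subschemeι ≫ σ' ≫ g) ∧ C.comap j = D

/-- **(T-a) = «the class the selector blows up next is served»**, unrestricted (`cls = ⊤`). -/
def ServesNext {O : Type} [CommRing O] {k : Type} [CommRing k] (θ : O →+* k)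
    (P : Scheme.{0}) (g : P ⟶ Spec (.of O)) (Y : Set P) : Prop :=
  sel.ServesNextOn (fun _ _ _ _ => True) θ P g Y

/-- Monotonicity in the class (bookkeeping, proved): serving a larger class serves a smaller one. -/
theorem ServesNextOn.mono {sel : Selector} {cls cls' : ∀ X₀ : Scheme.{0}, Set X₀ → List (Set X₀) → X₀.IdealSheafData → Prop}
    (hle : ∀ X₀ Y₀ B₀ D, cls X₀ Y₀ B₀ D → cls' X₀ Y₀ B₀ D)
    {O : Type} [CommRing O] {k : Type} [CommRing k] {θ : O →+* k} {P : Scheme.{0}} {g : P ⟶ Spec (.of O)} {Y : Set P}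
    (h : sel.ServesNextOn cls' θ P g Y) : sel.ServesNextOn cls θ P g Y :=
  fun X' X₀ σ' Y' B' j t B₀ μ D hr hD hc => h X' X₀ σ' Y' B' j t B₀ μ D hr hD (hle _ _ _ _ hc)

/-- `ServesNext` is `ServesNextOn` of every class (proved). -/
theorem ServesNext.on {sel : Selector} (cls : ∀ X₀ : Scheme.{0}, Set X₀ → List (Set X₀) → X₀.IdealSheafData → Prop)
    {O : Type} [CommRing O] {k : Type} [CommRing k] {θ : O →+* k} {P : Scheme.{0}} {g : P ⟶ Spec (.of O)} {Y : Set P}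
    (h : sel.ServesNext θ P g Y) : sel.ServesNextOn cls θ P g Y :=
  ServesNextOn.mono (fun _ _ _ _ _ => trivial) h


/-! ## §C — FORESEE (prefix-coherent lifting), typed; rows become COMPOSABLE

crit-2 TRIAGE-r3-2 sharpen (2), desk §7 (g)(2). On rows R3/R3′ (sections rigid on a prefix) and R2 (fibres of an OLDER ruling) the ∀-form `ServesNextOn`
is expected FALSE: the centre the selector picks at stage `m` lifts only if the EARLIER lifts were chosen coherently (tower-hilbert-closure T-1: the coherent
prefix is exactly what performs the refused round). FORESEE types this as an INVARIANT: a stage predicate `Good` (v4: of stages WITH presentation and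
memo, `StagePred`), true at the root for every presentation, such that at every `Good` stage the selected centre has a regular `O`-flat lift `C` EVERY
continuation of which (blow-up `τ` of `C`, presentation of the new special fibre, induced downstairs blow-up `ρ`, pushed memo) is again `Good`
(`ServesAlong Good`; `Foresees = ∃ Good`). The class-restricted `ServesAlongOn cls Good` adds the ROBUSTNESS clause «a selected centre NOT in `cls` keeps
`Good` under EVERY regular flat lift and every continuation», which is the precise obligation a row owes the other rows; with it, rows on DISJOINT classes
compose (`ServesAlongOn.union`) and the universal invariant `ShadowReach` turns every ∀-row into a FORESEE row (`ServesNextOn.servesAlongOn`).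
Assembly at selector level: classes covering everything the selector selects at `Good` stages give `ServesAlong` (`servesAlong_of_cover`), hence
`Foresees`, hence (crux currency) `ForeseeSupplementA`, which the re-targeted shape `stub_supplementF_shape` consumes. -/

/-- **FORESEE restricted to a class, with robustness.** `ServesAlongOn cls θ P g Y Good`: (root) `Good` holds at `(P, 𝟙, Y, [])` with every presentation
of the special fibre and the start memo; (serve) at a `Good` stage whose carried presentation is a model square, a selected centre `D ∈ cls` has a regular
`O`-flat lift `C` (`C.comap j = D`) such that EVERY continuation (blow-up `τ` of `C`, presentation `(j₂, t₂)`, induced downstairs blow-up `ρ` of `D`, memo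
`push ρ D μ`) is a `Good` stage; (robust) a selected centre `D ∉ cls` keeps `Good` under every regular `O`-flat lift and every continuation.
[OURS · typed obligation; for R3 the realism of the robustness clause — the O-flat coherence of the prefix (§D, «precise age ≥ 1 obstruction») must
survive the other rows' lift choices — is OPEN (tower-hilbert-closure T-1) and is exactly what the composition lemma exposes.] -/
def ServesAlongOn (cls : ∀ X₀ : Scheme.{0}, Set X₀ → List (Set X₀) → X₀.IdealSheafData → Prop)
    {O : Type} [CommRing O] {k : Type} [CommRing k] (θ : O →+* k)
    (P : Scheme.{0}) (g : P ⟶ Spec (.of O)) (Y : Set P) (Good : sel.StagePred k P) : Prop :=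
  (∀ (P₀ : Scheme.{0}) (j₀ : P₀ ⟶ P) (t₀ : P₀ ⟶ Spec (.of k)),
      IsPullback j₀ t₀ g (Spec.map (CommRingCat.ofHom θ)) → Good P (𝟙 P) Y [] P₀ j₀ t₀ [] (sel.init P₀ (j₀ ⁻¹' Y))) ∧
  ∀ (X' X₀ : Scheme.{0}) (σ' : X' ⟶ P) (Y' : Set X') (B' : List (Set X')) (j : X₀ ⟶ X') (t : X₀ ⟶ Spec (.of k))
    (B₀ : List (Set X₀)) (μ : sel.Memo X₀) (D : X₀.IdealSheafData),
    Good X' σ' Y' B' X₀ j t B₀ μ → IsPullback j t (σ' ≫ g) (Spec.map (CommRingCat.ofHom θ)) →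
    sel.next X₀ (j ⁻¹' Y') B₀ μ = some D →
    (cls X₀ (j ⁻¹' Y') B₀ D →
      ∃ C : X'.IdealSheafData, Literature.AlgebraicGeometry.Resolution.Scheme.IsRegular C.subscheme ∧
        Flat (C.subschemeι ≫ σ' ≫ g) ∧ C.comap j = D ∧
        ∀ (X₂ X₂₀ : Scheme.{0}) (τ : X₂ ⟶ X') (j₂ : X₂₀ ⟶ X₂) (t₂ : X₂₀ ⟶ Spec (.of k)) (ρ : X₂₀ ⟶ X₀), IsBlowup τ C →
          IsPullback j₂ t₂ ((τ ≫ σ') ≫ g) (Spec.map (CommRingCat.ofHom θ)) → ρ ≫ j = j₂ ≫ τ → IsBlowup ρ D →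
          Good X₂ (τ ≫ σ') (closure (τ ⁻¹' (Y' \ (C.support : Set X')))) ((τ ⁻¹' (C.support : Set X')) :: B'.map fun E => closure (τ ⁻¹' (E \ (C.support : Set X'))))
            X₂₀ j₂ t₂
            ((ρ ⁻¹' (D.support : Set X₀)) :: B₀.map fun E => closure (ρ ⁻¹' (E \ (D.support : Set X₀)))) (sel.push ρ (j ⁻¹' Y') B₀ D μ)) ∧
    (¬ cls X₀ (j ⁻¹' Y') B₀ D →
      ∀ C : X'.IdealSheafData, Literature.AlgebraicGeometry.Resolution.Scheme.IsRegular C.subscheme →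
        Flat (C.subschemeι ≫ σ' ≫ g) → C.comap j = D →
        ∀ (X₂ X₂₀ : Scheme.{0}) (τ : X₂ ⟶ X') (j₂ : X₂₀ ⟶ X₂) (t₂ : X₂₀ ⟶ Spec (.of k)) (ρ : X₂₀ ⟶ X₀), IsBlowup τ C →
          IsPullback j₂ t₂ ((τ ≫ σ') ≫ g) (Spec.map (CommRingCat.ofHom θ)) → ρ ≫ j = j₂ ≫ τ → IsBlowup ρ D →
          Good X₂ (τ ≫ σ') (closure (τ ⁻¹' (Y' \ (C.support : Set X')))) ((τ ⁻¹' (C.support : Set X')) :: B'.map fun E => closure (τ ⁻¹' (E \ (C.support : Set X'))))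
            X₂₀ j₂ t₂
            ((ρ ⁻¹' (D.support : Set X₀)) :: B₀.map fun E => closure (ρ ⁻¹' (E \ (D.support : Set X₀)))) (sel.push ρ (j ⁻¹' Y') B₀ D μ))

/-- **FORESEE, unrestricted**: `ServesAlong θ P g Y Good` — `Good` at the root (every presentation, start memo), and at every `Good` stage the selected
centre has a regular `O`-flat lift every continuation of which is `Good` (prefix-coherent lifting along `sel`). -/
def ServesAlong {O : Type} [CommRing O] {k : Type} [CommRing k] (θ : O →+* k)
    (P : Scheme.{0}) (g : P ⟶ Spec (.of O)) (Y : Set P) (Good : sel.StagePred k P) : Prop :=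
  (∀ (P₀ : Scheme.{0}) (j₀ : P₀ ⟶ P) (t₀ : P₀ ⟶ Spec (.of k)),
      IsPullback j₀ t₀ g (Spec.map (CommRingCat.ofHom θ)) → Good P (𝟙 P) Y [] P₀ j₀ t₀ [] (sel.init P₀ (j₀ ⁻¹' Y))) ∧
  ∀ (X' X₀ : Scheme.{0}) (σ' : X' ⟶ P) (Y' : Set X') (B' : List (Set X')) (j : X₀ ⟶ X') (t : X₀ ⟶ Spec (.of k))
    (B₀ : List (Set X₀)) (μ : sel.Memo X₀) (D : X₀.IdealSheafData),
    Good X' σ' Y' B' X₀ j t B₀ μ → IsPullback j t (σ' ≫ g) (Spec.map (CommRingCat.ofHom θ)) →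
    sel.next X₀ (j ⁻¹' Y') B₀ μ = some D →
    ∃ C : X'.IdealSheafData, Literature.AlgebraicGeometry.Resolution.Scheme.IsRegular C.subscheme ∧
      Flat (C.subschemeι ≫ σ' ≫ g) ∧ C.comap j = D ∧
      ∀ (X₂ X₂₀ : Scheme.{0}) (τ : X₂ ⟶ X') (j₂ : X₂₀ ⟶ X₂) (t₂ : X₂₀ ⟶ Spec (.of k)) (ρ : X₂₀ ⟶ X₀), IsBlowup τ C →
        IsPullback j₂ t₂ ((τ ≫ σ') ≫ g) (Spec.map (CommRingCat.ofHom θ)) → ρ ≫ j = j₂ ≫ τ → IsBlowup ρ D →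
        Good X₂ (τ ≫ σ') (closure (τ ⁻¹' (Y' \ (C.support : Set X')))) ((τ ⁻¹' (C.support : Set X')) :: B'.map fun E => closure (τ ⁻¹' (E \ (C.support : Set X'))))
          X₂₀ j₂ t₂
            ((ρ ⁻¹' (D.support : Set X₀)) :: B₀.map fun E => closure (ρ ⁻¹' (E \ (D.support : Set X₀)))) (sel.push ρ (j ⁻¹' Y') B₀ D μ)

/-- **(T-a, FORESEE form)**: some stage predicate serves the selector along the way. Weaker than `ServesNext` (`ServesNext.foresees`). -/
def Foresees {O : Type} [CommRing O] {k : Type} [CommRing k] (θ : O →+* k)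
    (P : Scheme.{0}) (g : P ⟶ Spec (.of O)) (Y : Set P) : Prop :=
  ∃ Good : sel.StagePred k P, sel.ServesAlong θ P g Y Good

/-- Every ∀-row is a FORESEE row with the universal invariant `ShadowReach` (proved): the served lift exists by `ServesNextOn`, and shadow-reachability
is robust under ANY regular flat lift and any continuation by `ShadowReach.step`. -/
theorem ServesNextOn.servesAlongOn {sel : Selector} {cls : ∀ X₀ : Scheme.{0}, Set X₀ → List (Set X₀) → X₀.IdealSheafData → Prop}
    {O : Type} [CommRing O] {k : Type} [CommRing k] {θ : O →+* k} {P : Scheme.{0}} {g : P ⟶ Spec (.of O)} {Y : Set P}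
    (h : sel.ServesNextOn cls θ P g Y) : sel.ServesAlongOn cls θ P g Y (sel.ShadowReach θ P g Y) := by
  refine ⟨fun P₀ j₀ t₀ hp₀ => ShadowReach.root hp₀, fun X' X₀ σ' Y' B' j t B₀ μ D hG _ hD => ⟨fun hc => ?_, ?_⟩⟩
  · obtain ⟨C, hreg, hfl, hcomap⟩ := h X' X₀ σ' Y' B' j t B₀ μ D hG hD hc
    exact ⟨C, hreg, hfl, hcomap, fun X₂ X₂₀ τ j₂ t₂ ρ hτ hp₂ hρ hρD => hG.step hD hreg hfl hcomap hτ hp₂ hρ hρD⟩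
  · intro _ C hreg hfl hcomap X₂ X₂₀ τ j₂ t₂ ρ hτ hp₂ hρ hρD
    exact hG.step hD hreg hfl hcomap hτ hp₂ hρ hρD

/-- **Composition of rows (proved).** Rows on DISJOINT classes compose: the classes join, the invariants conjoin. The robustness clause of each row is
what pays for the other row's freedom of choice. -/
theorem ServesAlongOn.union {sel : Selector} {cls₁ cls₂ : ∀ X₀ : Scheme.{0}, Set X₀ → List (Set X₀) → X₀.IdealSheafData → Prop}
    {O : Type} [CommRing O] {k : Type} [CommRing k] {θ : O →+* k} {P : Scheme.{0}} {g : P ⟶ Spec (.of O)} {Y : Set P}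
    {Good₁ Good₂ : sel.StagePred k P}
    (hdis : ∀ X₀ Y₀ B₀ D, cls₁ X₀ Y₀ B₀ D → ¬ cls₂ X₀ Y₀ B₀ D)
    (h₁ : sel.ServesAlongOn cls₁ θ P g Y Good₁) (h₂ : sel.ServesAlongOn cls₂ θ P g Y Good₂) :
    sel.ServesAlongOn (fun X₀ Y₀ B₀ D => cls₁ X₀ Y₀ B₀ D ∨ cls₂ X₀ Y₀ B₀ D) θ P g Y
      (fun X' σ' Y' B' X₀ j t B₀ μ => Good₁ X' σ' Y' B' X₀ j t B₀ μ ∧ Good₂ X' σ' Y' B' X₀ j t B₀ μ) := by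
  refine ⟨fun P₀ j₀ t₀ hp₀ => ⟨h₁.1 P₀ j₀ t₀ hp₀, h₂.1 P₀ j₀ t₀ hp₀⟩, fun X' X₀ σ' Y' B' j t B₀ μ D hG hp hD => ⟨?_, ?_⟩⟩
  · rintro (hc | hc)
    · obtain ⟨C, hreg, hfl, hcomap, hgood⟩ := (h₁.2 X' X₀ σ' Y' B' j t B₀ μ D hG.1 hp hD).1 hc
      exact ⟨C, hreg, hfl, hcomap, fun X₂ X₂₀ τ j₂ t₂ ρ hτ hp₂ hρ hρD => ⟨hgood X₂ X₂₀ τ j₂ t₂ ρ hτ hp₂ hρ hρD,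
        (h₂.2 X' X₀ σ' Y' B' j t B₀ μ D hG.2 hp hD).2 (hdis _ _ _ _ hc) C hreg hfl hcomap X₂ X₂₀ τ j₂ t₂ ρ hτ hp₂ hρ hρD⟩⟩
    · obtain ⟨C, hreg, hfl, hcomap, hgood⟩ := (h₂.2 X' X₀ σ' Y' B' j t B₀ μ D hG.2 hp hD).1 hc
      exact ⟨C, hreg, hfl, hcomap, fun X₂ X₂₀ τ j₂ t₂ ρ hτ hp₂ hρ hρD =>
        ⟨(h₁.2 X' X₀ σ' Y' B' j t B₀ μ D hG.1 hp hD).2 (fun h1 => hdis _ _ _ _ h1 hc) C hreg hfl hcomap X₂ X₂₀ τ j₂ t₂ ρ hτ hp₂ hρ hρD,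
          hgood X₂ X₂₀ τ j₂ t₂ ρ hτ hp₂ hρ hρD⟩⟩
  · intro hnot C hreg hfl hcomap X₂ X₂₀ τ j₂ t₂ ρ hτ hp₂ hρ hρD
    exact ⟨(h₁.2 X' X₀ σ' Y' B' j t B₀ μ D hG.1 hp hD).2 (fun h1 => hnot (Or.inl h1)) C hreg hfl hcomap X₂ X₂₀ τ j₂ t₂ ρ hτ hp₂ hρ hρD,
      (h₂.2 X' X₀ σ' Y' B' j t B₀ μ D hG.2 hp hD).2 (fun h2 => hnot (Or.inr h2)) C hreg hfl hcomap X₂ X₂₀ τ j₂ t₂ ρ hτ hp₂ hρ hρD⟩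

/-- **Cover ⇒ unrestricted FORESEE (proved).** If the class contains every centre the selector selects at `Good` stages, the class-restricted form gives
`ServesAlong Good`. -/
theorem ServesAlongOn.servesAlong_of_cover {sel : Selector} {cls : ∀ X₀ : Scheme.{0}, Set X₀ → List (Set X₀) → X₀.IdealSheafData → Prop}
    {O : Type} [CommRing O] {k : Type} [CommRing k] {θ : O →+* k} {P : Scheme.{0}} {g : P ⟶ Spec (.of O)} {Y : Set P}
    {Good : sel.StagePred k P}
    (h : sel.ServesAlongOn cls θ P g Y Good)
    (hcov : ∀ (X' X₀ : Scheme.{0}) (σ' : X' ⟶ P) (Y' : Set X') (B' : List (Set X')) (j : X₀ ⟶ X') (t : X₀ ⟶ Spec (.of k))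
      (B₀ : List (Set X₀)) (μ : sel.Memo X₀) (D : X₀.IdealSheafData), Good X' σ' Y' B' X₀ j t B₀ μ → IsPullback j t (σ' ≫ g) (Spec.map (CommRingCat.ofHom θ)) →
      sel.next X₀ (j ⁻¹' Y') B₀ μ = some D → cls X₀ (j ⁻¹' Y') B₀ D) :
    sel.ServesAlong θ P g Y Good :=
  ⟨h.1, fun X' X₀ σ' Y' B' j t B₀ μ D hG hp hD => (h.2 X' X₀ σ' Y' B' j t B₀ μ D hG hp hD).1 (hcov X' X₀ σ' Y' B' j t B₀ μ D hG hp hD)⟩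

/-- `ServesAlong Good → Foresees` (proved). -/
theorem ServesAlong.foresees {sel : Selector} {O : Type} [CommRing O] {k : Type} [CommRing k] {θ : O →+* k} {P : Scheme.{0}}
    {g : P ⟶ Spec (.of O)} {Y : Set P} {Good : sel.StagePred k P}
    (h : sel.ServesAlong θ P g Y Good) : sel.Foresees θ P g Y :=
  ⟨Good, h⟩

/-- **∀-form ⇒ FORESEE form** (proved): `ServesNext → Foresees`, with `Good := ShadowReach`. -/
theorem ServesNext.foresees {sel : Selector} {O : Type} [CommRing O] {k : Type} [CommRing k] {θ : O →+* k} {P : Scheme.{0}}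
    {g : P ⟶ Spec (.of O)} {Y : Set P} (h : sel.ServesNext θ P g Y) : sel.Foresees θ P g Y :=
  ((ServesNextOn.servesAlongOn h).servesAlong_of_cover fun _ _ _ _ _ _ _ _ _ _ _ _ _ => trivial).foresees

end Selector

/-- **The crux-currency wrapper** (v2 refactoring of v1's `TerminationSupplementA` text): for every input `(p, k, n = 3, H ↪ ℙ³_k)` of
`EquisingularLiftNatThree` (SAME binder prefix as the crux) there is a characteristic-0 DVR `O ↠ k` such that `Φ O k π ℙ³_O (structure map) Y` holds for
the image `Y` of `H` under every graded presentation `φ` of the reduction `π`. -/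
def SupplementWith
    (Φ : ∀ (O : Type) [CommRing O] (k : Type) [CommRing k], (O →+* k) → ∀ P : Scheme.{0}, (P ⟶ Spec (.of O)) → Set P → Prop) :
    Prop :=
  ∀ p : ℕ, p.Prime → ∀ (k : Type) [Field k] [CharP k p] [IsAlgClosed k] (n : ℕ) (H : Scheme.{0})
    (ι : H ⟶ (Literature.AlgebraicGeometry.Motives.projectiveSpace n k).left),
    IsClosedImmersion ι → AlgebraicGeometry.IsIntegral H →
    (∀ y : (Literature.AlgebraicGeometry.Motives.projectiveSpace n k).left,
      ∃ U : (Literature.AlgebraicGeometry.Motives.projectiveSpace n k).left.affineOpens,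
        y ∈ (U : (Literature.AlgebraicGeometry.Motives.projectiveSpace n k).left.Opens) ∧ (ι.ker.ideal U).IsPrincipal) →
    n = 3 →
    ∃ (O : Type) (_ : CommRing O) (_ : IsDomain O) (_ : IsDiscreteValuationRing O) (_ : CharZero O) (π : O →+* k),
      Function.Surjective π ∧
      (letI := MvPolynomial.gradedAlgebra (σ := Fin (n + 1)) (R := O)
       letI := MvPolynomial.gradedAlgebra (σ := Fin (n + 1)) (R := k)
       ∀ (φ : MvPolynomial.homogeneousSubmodule (Fin (n + 1)) O →+*ᵍ MvPolynomial.homogeneousSubmodule (Fin (n + 1)) k)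
         (hφ' : HomogeneousIdeal.irrelevant (MvPolynomial.homogeneousSubmodule (Fin (n + 1)) k) ≤
           (HomogeneousIdeal.irrelevant (MvPolynomial.homogeneousSubmodule (Fin (n + 1)) O)).map φ),
         (∀ s, φ s = MvPolynomial.map π s) →
         ∀ Y : Set (Proj (MvPolynomial.homogeneousSubmodule (Fin (n + 1)) O)),
           Y = Set.range (ι ≫ Proj.map φ hφ') →
           Φ O k π (Proj (MvPolynomial.homogeneousSubmodule (Fin (n + 1)) O))
             (Proj.toSpecZero (MvPolynomial.homogeneousSubmodule (Fin (n + 1)) O) ≫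
               Spec.map (CommRingCat.ofHom (algebraMap O (MvPolynomial.homogeneousSubmodule (Fin (n + 1)) O 0)))) Y)

/-- Monotonicity of the wrapper in `Φ` (bookkeeping, proved). -/
theorem SupplementWith.mono
    {Φ Ψ : ∀ (O : Type) [CommRing O] (k : Type) [CommRing k], (O →+* k) → ∀ P : Scheme.{0}, (P ⟶ Spec (.of O)) → Set P → Prop}
    (hle : ∀ (O : Type) [CommRing O] (k : Type) [CommRing k] (θ : O →+* k) (P : Scheme.{0}) (g : P ⟶ Spec (.of O)) (Y : Set P),
      Φ O k θ P g Y → Ψ O k θ P g Y)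
    (h : SupplementWith Φ) : SupplementWith Ψ := by
  intro p hp k iF iC iA n H ι hι hH hloc hn
  obtain ⟨O, iO, iD, iV, iZ, π, hπ, hrest⟩ := h p hp k n H ι hι hH hloc hn
  refine ⟨O, iO, iD, iV, iZ, π, hπ, ?_⟩
  intro φ hφ' hφ Y hY
  have h1 := hrest φ hφ' hφ Y hY
  exact hle O k π _ _ Y h1

namespace Selector

variable (sel : Selector)

/-- **(T-a) in the currency of the crux EL♮(3)** (v1 statement, now `SupplementWith ServesNext`): for every input `(p, k, n = 3, H ↪ ℙ³_k)` of
`EquisingularLiftNatThree` there is a characteristic-0 DVR `O ↠ k` over which the selector's centres are served at every shadow-reachable stage of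
`ℙ³_O ⊇ Y = H`. -/
def TerminationSupplementA : Prop :=
  SupplementWith fun _ _ _ _ θ P g Y => sel.ServesNext θ P g Y

/-- **(T-a, FORESEE form) in the currency of the crux** — the WEAKER supplement the shape now consumes: over some characteristic-0 DVR `O ↠ k`, some
invariant serves the selector along the way on `ℙ³_O ⊇ Y = H`. -/
def ForeseeSupplementA : Prop :=
  SupplementWith fun _ _ _ _ θ P g Y => sel.Foresees θ P g Y

/-- ∀-form supplement ⇒ FORESEE supplement (proved). -/
theorem terminationSupplementA_foresee : sel.TerminationSupplementA → sel.ForeseeSupplementA :=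
  SupplementWith.mono fun _ _ _ _ _ _ _ _ h => Selector.ServesNext.foresees h

end Selector

/-- **CONSTRUCTION statement (NEED-TYPING; not claimed, not a Literature fact in this form).** The canonical embedded resolution with boundary of
two-dimensional reduced excellent schemes [Cossart–Jannsen–Saito 2020 = LNM 2270, Thm. 1.4 with §§5–6 (canonicity; functoriality for automorphisms and
localisations); tree: `Literature.AlgebraicGeometry.Resolution.CossartJannsenSaito2020EmbeddedSequenceB` (∃-form only), `IsBPermissibleSequenceB`,
`IsSigmaOMaxProcess`] defines a well-shaped, iso-invariant selector on AGED MEMO states that resolves surfaces over every field. v4 (crit-2 TRIAGE-r5-2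
F1): the MEMO is where the constructor puts CJS's HISTORY FUNCTION `O : X → {subsets of 𝓑}` (LNM 2270 Def. 4.6, p. 55; `init`: `O = 𝓑`, Lemma 4.7;
`push`: the transform (4.6)/(4.7), p. 57, Lemma 4.13 — RESET to `𝓑'(x')` where the Hilbert–Samuel function drops, `Õ(x) ∩ 𝓑'(x')` where it does not) and
the LABELS («years») of the irreducible components of the maximal `H`-locus (p. 92, (6.5): inherited along domination, new components get the current
year); the aged list `B` is the boundary `𝓑` itself with its order of creation. What is asked of the constructor, exactly: `WellShaped` (regular centres
inside the trace at non-generic boundary-or-singular points), `IsoInvariant` = (next/init/push)-equivariance for isomorphisms of the AMBIENT scheme only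
(not localisation / étale invariance; for CJS: precomposition of `O` and of the labels with the homeomorphism), `Resolves k` for closed irreducible `Y` of
dimension ≤ 2 in a regular proper `S/k` of ANY dimension with EMPTY initial boundary and START memo (CJS Thm 1.4 bounds neither the ambient dimension nor
the field). Typing it = lead-2's CENTRE-EXPOSURE task (b); this `Prop` is the slot. Cheap sanity tests for a proposed inhabitant: (crit-3) a symmetric end
state reached by an asymmetric history must get the centre CJS prescribes from the ages/memo, not from the set `⋃ B`; (crit-2) two histories reaching the
same AGED state with different `O` (one passing through an `H`-drop, one not) must be distinguishable by the memo.
v5 — WHERE THE CONTENT LIVES (panel r7, concordant: crit-3 TRIAGE-r7-3 evidence 2 = crit-2 TRIAGE-r7-2 S-G4): `WellShaped ∧ IsoInvariant` alone are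
junk-inhabitable (the stopping selector `next ≡ none`); the content is `Resolves` COUPLED to (init)/(next): at a START state `(S, Y, [], init S Y)` and
`e ∈ Aut(S, Y)` (an automorphism of `S` with `e.hom ⁻¹' Y = Y`), (init) gives `transport e (init S Y) = init S Y` and (next) then forces the FIRST selected
centre to be `Aut(S, Y)`-INVARIANT (`D.comap e.hom = D`), inductively the whole run — so a bare existence theorem + `Classical.choice` does NOT inhabit this
slot (symmetric `(S, Y)` kill it), while any assignment `(S, Y) ↦` full blow-up sequence that is equivariant for isomorphisms of pairs, well-shaped and
resolving DOES (plan-memo `Memo S := Σ n, PlanTy S n`, crit-3).  The load-bearing obligation of lead-2's slot (b) is therefore CANONICITY FOR ISOMORPHISMS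
(LNM 2270 Thm. 6.9 (F1) / Prop. 6.31), in print.  IN STRICT-TRANSPORT FORM (v10, crit-2 TRIAGE-r11-2 S-G9 — the form lead-2's slot (b) must discharge,
quoted): «there is an assignment `(S, Y, B, μ) ↦ next centre`, equivariant under isomorphisms of the ambient `S` carrying `(Y, B, μ)` along, such that from
every start `(S, Y, [], init S Y)` (S regular proper over a field, `Y` closed irreducible of dimension ≤ 2) the run — trace by strict transform
`closure (τ⁻¹ (Y ∖ V(D)))`, boundary by `τ⁻¹ V(D) ::` STRICT transforms `closure (τ⁻¹ (E ∖ V(D)))` of the entries, memo by `push` — stops with the reduced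
closure of the trace regular; every selected centre regular, inside the closure of the trace, off its generic points unless in the boundary or singular»
(+ for `CJSSelectorExistsB`: «and normal crossing with THAT boundary list», CJS Thm. 6.9 (a) p. 83 / Def. 5.4).  MEMO GUARD (crit-3 TRIAGE-r10-3 S-G10): the
boundary LIST is advisory for `CJSSelectorExists` — an inhabitant may keep the true CJS boundary (with labels / history) in its memo and read the list only
through `⋃ B` (`WellShaped`); only `BPermissible` makes the list itself load-bearing.  Selector-SPECIFIC behaviour a row consumes is NOT exposed by this ∃-slot: it goes into named conjuncts
(`BPermissible`, slot `CJSSelectorExistsB` below), or the row is proved for every well-shaped selector (as `servesNextOn_R1`). -/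
def CJSSelectorExists : Prop :=
  ∃ sel : Selector, sel.WellShaped ∧ sel.IsoInvariant ∧ ∀ (k : Type) [Field k], sel.Resolves k

/-- **Strengthened construction slot (v5; crit-3 TRIAGE-r7-3 sharpen (a))**: as `CJSSelectorExists`, plus the named conjunct `BPermissible` (selected
centres n.c. with the aged boundary, CJS Def. 5.2/5.4).  NEED-TYPING of the inhabitant as before (lead-2 (b)); nothing claimed.  Rows that consume
𝓑-permissibility (jump-class-steering's R3-3 order lemma, tower-hilbert-closure's member retention) are to be stated against THIS slot; `CJSSelectorExists`
stays the byte-identical target of desk R20-bis. -/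
def CJSSelectorExistsB : Prop :=
  ∃ sel : Selector, sel.WellShaped ∧ sel.BPermissible ∧ sel.IsoInvariant ∧ ∀ (k : Type) [Field k], sel.Resolves k

/-- The strengthened slot implies the slot (proved; bookkeeping). -/
theorem CJSSelectorExistsB.weaken (h : CJSSelectorExistsB) : CJSSelectorExists := by
  obtain ⟨sel, hws, -, hiso, hres⟩ := h
  exact ⟨sel, hws, hiso, hres⟩

/-- **SUPPLEMENT SHAPE, FORESEE form (v2 target; v4 memo states)** `WellShaped ∧ IsoInvariant ∧ Resolves ∧ ForeseeSupplementA ⟹ EL♮(3)` — PLUMBING of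
size M/L, stated as a named stub so that the line can cite the shape; NOT a skeleton stub (R10/R16 (ii)), not registered. Route of proof (docstring only,
nothing asserted): take `O ↠ k` and the stage predicate `Good` from `ForeseeSupplementA`; run the downstairs `Run` that `Resolves k` provides on the special
fibre `ℙ³_k ⊇ H` of `ℙ³_O` from `(ℙ³_k, H, [], init)`; INVARIANT along the construction: the current upstairs stage `(X', σ', Y', B')` carries a presentation
`(X₀, j, t)`, the CARRIED downstairs aged boundary `B₀` (v10, C1) and memo `μ`, is `Good`, and there is an isomorphism `e : X₀ ≅ S_i` onto the `i`-th scheme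
of the downstairs run transporting trace, aged boundary (`B₀ = B_i.map (e.hom ⁻¹' ·)` — since v10 this holds BY CONSTRUCTION: `ShadowReach`'s step
transports `B₀` by `Run.step`'s own recipe along `ρ`, crit-3 TRIAGE-r10-3 S-G9) and memo (`μ = transport e μ_i`); then `IsoInvariant` (next) identifies
`sel.next` on the presentation with the run's next centre `D_i`,
`ServesAlong` gives the lift `C` of `D` AND that every continuation is `Good`; blow `C` up (`τ`), present the new special fibre by the fibre product
(`ShadowReach.step_pullback`'s data): the induced `ρ` IS `Bl_D X₀` by `IsBlowup.of_isPullback_of_flat_exceptional` GIVEN `Flat (E_C → Spec O)` =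
`exceptional_flat` (`C` regular and `O`-flat in the regular `X'`), so `IsBlowup.unique`-type comparison gives `e' : X₂₀ ≅ S_{i+1}` compatible with
`ρ` and `τ_i`, and `IsoInvariant` (push) propagates the memo relation; the exceptional part `ℙ(N_C)|_D = ℙ(N_{D/X₀})` lies in the strict transform, so the
new special fibre is again IRREDUCIBLE and its downstairs boundary list is `Run.step`'s (head exactness upstairs: `ShadowReach.head?_eq`); E1 holds because `V(C) ∩ (special fibre) = V(D) ⊆ closure Y'`
(`WellShaped`); regularity of the stages and of their special fibres is preserved (blow-ups of regular schemes in regular centres); when the run stops the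
reduced closure of the trace is regular (`Resolves`). Honest status: for the CJS selector `Foresees` is OPEN on the card's rows R3/R3′/R4/R7/R8, so this
shape does NOT prove EL♮(3); it is the TARGET FORM into which served classes (`ServesAlongOn`, composed by `union`, closed by `servesAlong_of_cover`) are
accumulated. (T-b) not claimed. -/
theorem stub_supplementF_shape (sel : Selector) :
    sel.WellShaped → sel.IsoInvariant → (∀ (k : Type) [Field k], sel.Resolves k) → sel.ForeseeSupplementA →
      Summit.ResolutionOfSingularities.ResolutionOfSingularities.Theses.EquisingularLift.EquisingularLiftNatThree := by
  sorry

/-- **SUPPLEMENT SHAPE, ∀-form** (v1's statement and name; DERIVED from the FORESEE shape via `terminationSupplementA_foresee` — no `sorry` of its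
own, conditional on `stub_supplementF_shape`). -/
theorem stub_supplementA_shape (sel : Selector) :
    sel.WellShaped → sel.IsoInvariant → (∀ (k : Type) [Field k], sel.Resolves k) → sel.TerminationSupplementA →
      Summit.ResolutionOfSingularities.ResolutionOfSingularities.Theses.EquisingularLift.EquisingularLiftNatThree :=
  fun hws hiso hres hT => stub_supplementF_shape sel hws hiso hres (sel.terminationSupplementA_foresee hT)

/-! ## §D — the R1 CUSTOMER of the ∀-form (crit-2 TRIAGE-r3-2 (1), desk §7 (g)(1)) and the AGE PRINCIPLE

AGE PRINCIPLE. In the ∀-form the upstairs stage `X'` was produced by blowing up ARBITRARY regular `O`-flat lifts `C₁, …, C_m` of the selected centres. What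
survives arbitrary choices is exactly the AGE-0 datum: the youngest boundary entry upstairs IS the exceptional divisor `E_m = ℙ(N_{C_m}) → C_m` of the last
blow-up — regular, proper and `O`-flat (because `C_m` is), with special fibre `ℙ(N_{C_m}) ×_O k = ℙ(N_{D_m})` = the youngest entry downstairs with its
REDUCED structure (`stub_R1a`, PLUMBING). Hence a class that reads only the youngest entry — R1 = «the selected centre lies in the youngest exceptional
component and is, inside it, a local complete intersection with Čech-acyclic normal sheaf» — is served by the engine `EmbeddedLiftFact` applied to
`W = E_m` (the exact hypothesis shape of `EmbeddedLiftFact`, hosted by the fresh component instead of the tower's `V(𝓔)`), then pushed forward to `X'`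
(`stub_R1b`, ENGINE + plumbing). Entries of age ≥ 1 are strict transforms of older exceptional divisors under LATER arbitrary blow-ups: their geometry
upstairs depends on the choices (R2 = fibres of an older ruling, R3/R3′ = sections rigid on a prefix) — those rows are FORESEE rows (§C), not ∀-rows.
THE PRECISE AGE ≥ 1 OBSTRUCTION (crit-3 TRIAGE-r5-3 (B)(4)/(a), v3): the would-be host for a reader of the entry of age `k ≥ 1` is the strict transform
`St(E_{m-k}) = Bl_{C ∩ E_{m-k}} E_{m-k}` (iterated), whose special fibre is the downstairs strict transform of `E_{m-k} ×_O k` ONLY IF the scheme-theoretic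
intersections `C_i ∩ E_{m-k}` of the later centres with it are `O`-flat — false for arbitrary lifts `C_i`. So what fails at age ≥ 1 is the MODEL-SQUARE
hypothesis of `EmbeddedLiftFact` (host proper flat over `O` with the prescribed special fibre), not a regularity hypothesis (`EmbeddedLiftFact` asks no
regularity of its host and returns none of `C`; the regularity of `C` in `stub_R1b` is the separate step «proper flat over the DVR with regular special fibre
⇒ regular»). A FORESEE invariant `Good` for such a row is therefore an O-FLATNESS (coherence) condition on the prefix of lifts: «every later centre meets
the retained older components O-flatly» — exactly what rows R3/R3′ must carry in `ServesAlongOn`'s robustness clause, and what an (a″) specimen must break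
(crit-3's DEGREE TEST: an earlier centre admitting an INCOHERENT O-flat lift, e.g. of positive `H`-degree inside an old component).
R1 proper of the card (sections `D` with `D² ≥ −1` of the fresh `ℙ¹`-bundle `F_n → Z` over a rational carrier; `N_{D/E₀} = 𝒪(D²)`, `Ȟ¹ = 0` on two charts,
`D ≅ ℙ¹`: `DirStepRatFinite` / T-P1VB) is contained in `clsR1`. -/

/-- **Class R1 (age-0 reader).** `clsR1 X₀ Y₀ B₀ D`: the youngest boundary entry `E₀ = B₀.head` is closed and contains `V(D)`; `V(D)` sits inside the
REDUCED closed subscheme `redSub X₀ E₀` on `E₀` by a closed immersion `ι₀` compatible with the two embeddings into `X₀`; and `ι₀` is, affine-locally on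
`redSub X₀ E₀`, cut out by weakly regular sequences (local complete intersection) with a 2-chart affine cover of `V(D)` on which the normal sheaf
`normalSheaf ι₀` has `Subsingleton` first Čech cohomology — VERBATIM the hypothesis shape of `EmbeddedLiftFact`. -/
def clsR1 (X₀ : Scheme.{0}) (_Y₀ : Set X₀) (B₀ : List (Set X₀)) (D : X₀.IdealSheafData) : Prop :=
  ∃ (E₀ : Set X₀) (hE₀ : IsClosed E₀), B₀.head? = some E₀ ∧ (D.support : Set X₀) ⊆ E₀ ∧
    ∃ ι₀ : D.subscheme ⟶ redSub X₀ E₀ hE₀, IsClosedImmersion ι₀ ∧ ι₀ ≫ redSubι X₀ E₀ hE₀ = D.subschemeι ∧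
      (∀ z : D.subscheme, ∃ U : (redSub X₀ E₀ hE₀).affineOpens, ι₀.base z ∈ (U : (redSub X₀ E₀ hE₀).Opens) ∧
        ∃ rs : List Γ(redSub X₀ E₀ hE₀, U),
          RingTheory.Sequence.IsWeaklyRegular Γ(redSub X₀ E₀ hE₀, U) rs ∧ Ideal.ofList rs = ι₀.ker.ideal U) ∧
      ∃ V : Fin 2 → D.subscheme.Opens, (∀ i, IsAffineOpen (V i)) ∧ IsAffineOpen (V 0 ⊓ V 1) ∧ ⨆ i, V i = ⊤ ∧
        Subsingleton (CechMH1 D.subscheme.toSpecΓ (normalSheaf ι₀) V)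

/-- **`exceptional_flat` (v4/v5 `stub_exceptional_flat`; v6: PROVED BY NAME from the tree — line `strata-split`'s
`Cruxes.EquisingularLift.StrataSplit.flat_exceptional_of_isBlowup_regularCentre`, [Liu2002 Thm. 8.1.19 (b)], whose statement is this one verbatim incl. the
S-G3 binder `[IsLocallyNoetherian X₁]`) — the ONE plumbing lemma of F2 (crit-2 TRIAGE-r5-2 F2 / sharpen S2): the
exceptional divisor of the blow-up of a regular `O`-flat centre in a regular scheme is flat over `O`.** For `f : X₁ → Spec O`, `X₁` regular, `C = V(𝓘)`
a regular closed subscheme with `V(C) → Spec O` flat, and `τ : X₂ → X₁` the blow-up of `C`: `E_C = V(𝓘 · 𝒪_{X₂}) → Spec O` is flat. Route (nothing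
asserted): `C ↪ X₁` is a regular immersion (both regular), so `gr_𝓘 𝒪_{X₁} = Sym(𝓘/𝓘²)` with `𝓘/𝓘²` locally free on `C`, hence `E_C = Proj_C(⊕ 𝓘ⁿ/𝓘ⁿ⁺¹) =
ℙ(N_C) → C` is a projective bundle — flat (indeed smooth) over `C` — and `C → Spec O` is flat; compose. This is the instance hypothesis of
`ShadowReach.step_pullback` in the regular regime, i.e. exactly what the proof routes of `stub_supplementF_shape` (special fibre of `Bl_C X'` is
`Bl_D X'₀`) and `stub_R1a` (special fibre of `E_C` is `E_D = ℙ(N_D)`, reduced) consume; base `O` arbitrary.  v5 (crit-2 TRIAGE-r7-2 S-G3): `X₁` is assumed LOCALLY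
NOETHERIAN (stalkwise regularity alone does not make `𝓘` locally generated by a regular sequence on a neighbourhood; every consumer has `X₁` of finite
type over a DVR). -/
theorem exceptional_flat {O : Type} [CommRing O] {X₁ X₂ : Scheme.{0}} [IsLocallyNoetherian X₁] (f : X₁ ⟶ Spec (.of O))
    (hX₁ : Literature.AlgebraicGeometry.Resolution.Scheme.IsRegular X₁) (C : X₁.IdealSheafData)
    (hC : Literature.AlgebraicGeometry.Resolution.Scheme.IsRegular C.subscheme) (hCf : Flat (C.subschemeι ≫ f))
    {τ : X₂ ⟶ X₁} (hτ : IsBlowup τ C) : Flat ((C.comap τ).subschemeι ≫ τ ≫ f) :=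
  Summit.ResolutionOfSingularities.ResolutionOfSingularities.Cruxes.EquisingularLift.StrataSplit.flat_exceptional_of_isBlowup_regularCentre
    O X₁ X₂ f C hX₁ hC hCf τ hτ

/-- **`stub_R1a` — PLUMBING (size M/L; not a skeleton stub, not registered): the youngest boundary entry upstairs is a fresh exceptional divisor.**
At a shadow-reachable stage `(X', σ', Y', B'; X₀, j, t, μ)` over `θ : O ↠ k` from a regular root `P`, proper over `O`, with regular special fibres, whose
youngest entry is `E = B'.head`: there is a closed subscheme `W = V(𝓦) ⊆ X'` with support `E`, REGULAR, PROPER and FLAT over `O`, whose special fibre —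
for the carried presentation `(j, t)` of the special fibre `X₀` of `X'` (a model square by `ShadowReach.isPullback`) — is the REDUCED closed subscheme of
`X₀` on `j⁻¹ E`, by a model square `(jW, redSubι ≫ t)` over `θ` compatible with `j`. Route (nothing asserted): induct along `ShadowReach` on the invariant
«`X'` regular, its special fibre regular, and (if `B' ≠ []`) the head is such a `W`»: root — `hP`, `hP₀`, `B' = []`; step — `W := E_C = V(C · 𝒪_{X₂})`, the
exceptional divisor of `τ : X₂ = Bl_C X₁ → X₁`, `= ℙ(N_{C/X₁})` since `C`, `X₁` are regular, smooth over `C` hence proper over `O` and FLAT over `O`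
(`exceptional_flat`); its special fibre along the continuation `(j₂, t₂, ρ)`: the downstairs `ρ` is `Bl_D X₀` (stage datum `IsBlowup ρ D`, produced by
`IsBlowup.of_isPullback_of_flat_exceptional` from the same flatness — `ShadowReach.step_pullback`), and `E_C ×_{X₂} X₂₀ = V(D · 𝒪_{X₂₀}) = E_D = ℙ(N_{D/X₀})` —
`N_{C/X₁}|_D = N_{D/X₀}` by `O`-flatness of `C` and of `X₁` (crit-3 TRIAGE-r12-3 S-G12), so `(E_C)_k = ℙ(N_{D/X₀}) = ρ⁻¹ V(D)` —
REGULAR (as `D`, `X₀` are — `WellShaped`, invariant) hence reduced, with support `j₂⁻¹(τ⁻¹ V(C))` (`ShadowReach.head?_eq`); `X₂` and `X₂₀` regular (blow-ups of regular schemes in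
regular centres). For whole prefixes the tree's `CentreSeq.isPullback_comap_specMap_of_exceptionalFlatOver` (BlowupSequencesBaseChange) is the same
statement sequence-wise. -/
theorem stub_R1a (sel : Selector) (hws : sel.WellShaped)
    {O : Type} [CommRing O] [IsDomain O] [IsDiscreteValuationRing O] {k : Type} [Field k] (θ : O →+* k)
    (P : Scheme.{0}) (g : P ⟶ Spec (.of O)) (Y : Set P)
    (hP : Literature.AlgebraicGeometry.Resolution.Scheme.IsRegular P) (hg : IsProper g)
    (hP₀ : ∀ (P₀ : Scheme.{0}) (j₀ : P₀ ⟶ P) (t₀ : P₀ ⟶ Spec (.of k)),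
      IsPullback j₀ t₀ g (Spec.map (CommRingCat.ofHom θ)) → Literature.AlgebraicGeometry.Resolution.Scheme.IsRegular P₀)
    {X' X₀ : Scheme.{0}} {σ' : X' ⟶ P} {Y' : Set X'} {B' : List (Set X')} {j : X₀ ⟶ X'} {t : X₀ ⟶ Spec (.of k)} {B₀ : List (Set X₀)} {μ : sel.Memo X₀}
    (hr : sel.ShadowReach θ P g Y X' σ' Y' B' X₀ j t B₀ μ)
    {E : Set X'} (hE : B'.head? = some E) (hE₀ : IsClosed (j ⁻¹' E)) :
    ∃ W : X'.IdealSheafData, (W.support : Set X') = E ∧ IsProper (W.subschemeι ≫ σ' ≫ g) ∧ Flat (W.subschemeι ≫ σ' ≫ g) ∧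
      Literature.AlgebraicGeometry.Resolution.Scheme.IsRegular W.subscheme ∧
      ∃ jW : redSub X₀ (j ⁻¹' E) hE₀ ⟶ W.subscheme,
        IsPullback jW (redSubι X₀ (j ⁻¹' E) hE₀ ≫ t) (W.subschemeι ≫ σ' ≫ g) (Spec.map (CommRingCat.ofHom θ)) ∧
        jW ≫ W.subschemeι = redSubι X₀ (j ⁻¹' E) hE₀ ≫ j := by
  sorry
/-- **`stub_R1b` — ENGINE + plumbing (size M modulo the hypothesis `EmbeddedLiftFact`; not a skeleton stub, not registered): serve an R1 centre inside a
fresh proper flat regular host.** Given a complete DVR `O ↠ k`, `f : X' → Spec O` with special fibre `(j, t)`, a closed `W = V(𝓦) ⊆ X'` regular, proper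
and flat over `O` with special fibre the reduced subscheme on `E₀ ⊆ X₀` (model square `(jW, redSubι ≫ t)`, compatible with `j`), and a REGULAR `D` on `X₀`
factoring through `redSub X₀ E₀` by a closed immersion `ι₀` which is a local complete intersection with 2-chart Čech-acyclic normal sheaf: `D` has a
REGULAR `O`-flat lift `C` on `X'` with `C.comap j = D`. Route (nothing asserted): `EmbeddedLiftFact` on `(W.subscheme, W.subschemeι ≫ f, redSub X₀ E₀, jW,
redSubι ≫ t, ι₀)` gives `C_W` on `W.subscheme`, flat over `O`, `C_W.comap jW = ι₀.ker`; `C := (C_W.subschemeι ≫ W.subschemeι).ker`; flatness is that of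
`V(C_W)`; `C.comap j = D` from the two pullback squares (`W.subscheme ×_{X'} X₀ = redSub X₀ E₀` via `jW`) and `ι₀ ≫ redSubι = D.subschemeι`
(`D.subschemeι.ker = D`); REGULARITY of `V(C)`: proper and flat over the DVR `O` with special fibre `V(D)` regular ⇒ regular at every point of the special
fibre (a regular sequence extended by the uniformiser), every closed point of the proper `V(C)` lies on the special fibre, a Noetherian scheme regular at
its closed points is regular. -/
theorem stub_R1b (hJ1 : EmbeddedLiftFact)
    {O : Type} [CommRing O] [IsDomain O] [IsDiscreteValuationRing O] [IsAdicComplete (maximalIdeal O) O]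
    {k : Type} [Field k] (θ : O →+* k) (hθ : Function.Surjective θ)
    {X' X₀ : Scheme.{0}} (f : X' ⟶ Spec (.of O)) {j : X₀ ⟶ X'} {t : X₀ ⟶ Spec (.of k)}
    (hp : IsPullback j t f (Spec.map (CommRingCat.ofHom θ)))
    (W : X'.IdealSheafData) (hWp : IsProper (W.subschemeι ≫ f)) (hWf : Flat (W.subschemeι ≫ f))
    (hWreg : Literature.AlgebraicGeometry.Resolution.Scheme.IsRegular W.subscheme)
    {E₀ : Set X₀} (hE₀ : IsClosed E₀) (jW : redSub X₀ E₀ hE₀ ⟶ W.subscheme)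
    (hsq : IsPullback jW (redSubι X₀ E₀ hE₀ ≫ t) (W.subschemeι ≫ f) (Spec.map (CommRingCat.ofHom θ)))
    (hcomm : jW ≫ W.subschemeι = redSubι X₀ E₀ hE₀ ≫ j)
    (D : X₀.IdealSheafData) (hD : Literature.AlgebraicGeometry.Resolution.Scheme.IsRegular D.subscheme)
    (ι₀ : D.subscheme ⟶ redSub X₀ E₀ hE₀) (hι₀ : IsClosedImmersion ι₀) (hfac : ι₀ ≫ redSubι X₀ E₀ hE₀ = D.subschemeι)
    (hlci : ∀ z : D.subscheme, ∃ U : (redSub X₀ E₀ hE₀).affineOpens, ι₀.base z ∈ (U : (redSub X₀ E₀ hE₀).Opens) ∧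
      ∃ rs : List Γ(redSub X₀ E₀ hE₀, U),
        RingTheory.Sequence.IsWeaklyRegular Γ(redSub X₀ E₀ hE₀, U) rs ∧ Ideal.ofList rs = ι₀.ker.ideal U)
    (hcech : ∃ V : Fin 2 → D.subscheme.Opens, (∀ i, IsAffineOpen (V i)) ∧ IsAffineOpen (V 0 ⊓ V 1) ∧ ⨆ i, V i = ⊤ ∧
      Subsingleton (CechMH1 D.subscheme.toSpecΓ (normalSheaf ι₀) V)) :
    ∃ C : X'.IdealSheafData, Literature.AlgebraicGeometry.Resolution.Scheme.IsRegular C.subscheme ∧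
      Flat (C.subschemeι ≫ f) ∧ C.comap j = D := by
  sorry

/-- **The R1 customer (crit-2 TRIAGE-r3-2 (1)) — KERNEL-CHECKED REDUCTION to `stub_R1a` + `stub_R1b`.** For every well-shaped selector (any memo), over a
complete DVR `O ↠ k`, on a regular root `P` proper over `O` with regular special fibres: the class `clsR1` (age-0 reader) is served in the ∀-form
`ServesNextOn`, GIVEN the hypothesis `EmbeddedLiftFact` (J1 / F-88 lineage, exactly as CHILD v33 consumes it). This is the cheapest evidence that
`ServesNextOn` is the right currency for age-0 rows; it does NOT depend on the selector's identity nor on its memo. -/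
theorem servesNextOn_R1 (hJ1 : EmbeddedLiftFact) (sel : Selector) (hws : sel.WellShaped)
    {O : Type} [CommRing O] [IsDomain O] [IsDiscreteValuationRing O] [IsAdicComplete (maximalIdeal O) O]
    {k : Type} [Field k] (θ : O →+* k) (hθ : Function.Surjective θ)
    (P : Scheme.{0}) (g : P ⟶ Spec (.of O)) (Y : Set P)
    (hP : Literature.AlgebraicGeometry.Resolution.Scheme.IsRegular P) (hg : IsProper g)
    (hP₀ : ∀ (P₀ : Scheme.{0}) (j₀ : P₀ ⟶ P) (t₀ : P₀ ⟶ Spec (.of k)),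
      IsPullback j₀ t₀ g (Spec.map (CommRingCat.ofHom θ)) → Literature.AlgebraicGeometry.Resolution.Scheme.IsRegular P₀) :
    sel.ServesNextOn clsR1 θ P g Y := by
  intro X' X₀ σ' Y' B' j t B₀ μ D hr hD hcls
  have hp := hr.isPullback
  obtain ⟨E₀, hE₀, hhead, -, ι₀, hι₀, hfac, hlci, hcech⟩ := hcls
  rw [hr.head?_eq, List.head?_map] at hhead
  obtain ⟨E, hE, hEE₀⟩ := Option.map_eq_some_iff.mp hhead
  subst hEE₀
  have hDreg : Literature.AlgebraicGeometry.Resolution.Scheme.IsRegular D.subscheme :=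
    (hws X₀ (j ⁻¹' Y') B₀ μ D hD).1
  obtain ⟨W, -, hWp, hWf, hWreg, jW, hsq, hcomm⟩ := stub_R1a sel hws θ P g Y hP hg hP₀ hr hE hE₀
  exact stub_R1b hJ1 θ hθ (σ' ≫ g) hp W hWp hWf hWreg hE₀ jW hsq hcomm D hDreg ι₀ hι₀ hfac hlci hcech
/-- Consequently (proved from the two stubs): R1 is also a FORESEE row with the universal invariant, ready for `ServesAlongOn.union`. -/
theorem servesAlongOn_R1 (hJ1 : EmbeddedLiftFact) (sel : Selector) (hws : sel.WellShaped)
    {O : Type} [CommRing O] [IsDomain O] [IsDiscreteValuationRing O] [IsAdicComplete (maximalIdeal O) O]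
    {k : Type} [Field k] (θ : O →+* k) (hθ : Function.Surjective θ)
    (P : Scheme.{0}) (g : P ⟶ Spec (.of O)) (Y : Set P)
    (hP : Literature.AlgebraicGeometry.Resolution.Scheme.IsRegular P) (hg : IsProper g)
    (hP₀ : ∀ (P₀ : Scheme.{0}) (j₀ : P₀ ⟶ P) (t₀ : P₀ ⟶ Spec (.of k)),
      IsPullback j₀ t₀ g (Spec.map (CommRingCat.ofHom θ)) → Literature.AlgebraicGeometry.Resolution.Scheme.IsRegular P₀) :
    sel.ServesAlongOn clsR1 θ P g Y (sel.ShadowReach θ P g Y) :=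
  (servesNextOn_R1 hJ1 sel hws θ hθ P g Y hP hg hP₀).servesAlongOn


/-! ### The germ-clock row R3, typed as a class and a target (crit-2 TRIAGE-r8-2 S-G5; v8)

Nothing is claimed here: `clsR3carrier` is the CLASS of selected centres the germ clock speaks about, `TargetR3` the row statement in FORESEE currency.
The (a″) falsifier of the card (first stage with `B ≠ []` whose CJS centre is a curve with transversal `A_m`-germ, `m ≥ 2`, on the census families
(T-B)/T23-D) must exhibit, for the intended inhabitant `sel_CJS` of `CJSSelectorExistsB`, a root `(P, g, Y)` of the crux's shape with `¬ TargetR3 sel_CJS θ P g Y`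
— i.e. that NO stage predicate `Good` serves this class along the CJS run; until a kit-enabled seat runs it the row is OPEN with no evidence either way. -/

/-- **Class R3 (carrier rounds at age ≥ 1)**: the stage has a non-empty aged boundary, and the selected centre `D` passes through a point `v` of the
REDUCED CLOSURE of the trace at which that reduced closure has a ONE-dimensional NON-regular local ring (the generic point `η_Z` of an equimultiple curve
`Z` of a surface trace with singular transversal germ) and `D` is reduced there along the trace (`(D|_trace)_v = 𝔪_v`) — exactly the hypotheses under
which `GermClockDeltaSquare.germDelta_round_lt` makes the clock `δ(𝒪_{trace,v})` tick. [OURS · class predicate, no claim] -/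
def clsR3carrier (X₀ : Scheme.{0}) (Y₀ : Set X₀) (B₀ : List (Set X₀)) (D : X₀.IdealSheafData) : Prop :=
  B₀ ≠ [] ∧ ∃ v : redSub X₀ (closure Y₀) isClosed_closure,
    redSubι X₀ (closure Y₀) isClosed_closure v ∈ (D.support : Set X₀) ∧
    ringKrullDim ((redSub X₀ (closure Y₀) isClosed_closure).presheaf.stalk v) = 1 ∧
    ¬ IsRegularLocalRing ((redSub X₀ (closure Y₀) isClosed_closure).presheaf.stalk v) ∧
    Literature.AlgebraicGeometry.Resolution.stalkIdeal (D.comap (redSubι X₀ (closure Y₀) isClosed_closure)) v =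
      maximalIdeal ((redSub X₀ (closure Y₀) isClosed_closure).presheaf.stalk v)

/-- **Row R3 as a typed TARGET (FORESEE currency; a `Prop`, nothing claimed)**: some stage predicate `Good` serves the carrier class along `sel` over
`θ : O → k` on the root `(P, g, Y)` — `Good` at the root for every presentation, every `Good` stage's selected R3-centre has a regular `O`-flat lift all of
whose continuations are `Good`, and non-R3 centres keep `Good` (`ServesAlongOn`).  Per-row `∃ Good` targets COMPOSE (`ServesAlongOn.union` takes
`Good₁ ∧ Good₂` for disjoint classes), so this is the honest unit of the ledger of rows; the germ clock is the well-founded quantity a `Good` for this row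
can be built on (strict drop `germDelta_round_lt`, silence `germDelta_round_eq_of_not_mem`), the O-flat coherence of the prefix (§D «precise age ≥ 1
obstruction») is what it must additionally carry — OPEN. -/
def TargetR3 (sel : Selector) {O : Type} [CommRing O] {k : Type} [CommRing k] (θ : O →+* k)
    (P : Scheme.{0}) (g : P ⟶ Spec (.of O)) (Y : Set P) : Prop :=
  ∃ Good : sel.StagePred k P, sel.ServesAlongOn clsR3carrier θ P g Y Good

/-! ## §E — the δ-DROP BY NAME (desk §7 (g)(3)): already in the tree; what the germ clock still needs

FINDING (g4): the presentation of a quadratic transform as an `IsFirstNeighbourhood` family, so that the strict drop applies BY NAME, is ALREADY LANDED: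
`Literature.AlgebraicGeometry.Resolution.IsBlowup.isFirstNeighbourhood_fibreSubalgebra` (BlowupPointDeltaDrop) presents the blow-up of an integral
quasi-excellent curve `C` at a singular closed point `c` as a first-neighbourhood family of `𝒪_{C,c}`; `IsBlowup.sum_curveDelta_fibre_lt`,
`IsBlowup.finsum_pointDelta_lt` (CurveBlowupDeltaDrop) give `Σ_{c' ↦ c} δ(c') < δ(c)`; `IsBlowup.finsum_pointDelta_strictTransform_lt`
(StrictTransformCurveDelta; hypotheses `[IsIntegral C] [IsNoetherian C]`, `Scheme.IsQuasiExcellent C`, `topologicalKrullDim C ≤ 1`,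
`ringKrullDim 𝒪_{C,c} = 1`, `¬ IsDiscreteValuationRing 𝒪_{C,c}`) gives it for the STRICT TRANSFORM of an embedded curve under the blow-up of the ambient
at the point; `IsBlowup.of_isPullback_of_flat` / `IsBlowup.pullback_snd_of_flat` (BlowupsFlatBaseChange) give flat base change of blow-ups. So §A's
`delta_descent` (growth of the ring) and the tree (strict drop of δ) together make the clock STRICTLY MONOTONE once the round is LOCALISED:
what remains for the generic-germ clock of the card is the LOCALISATION SQUARE only — for a round blowing up a regular curve `Z ⊆ Y' ⊂ G` (downstairs
ambient `G` regular, `Y'` the reduced trace, `η_Z` the generic point of `Z`): the base change of the round along the flat `Spec 𝒪_{G,η_Z} → G` is the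
blow-up of the regular 2-dimensional local scheme `Spec 𝒪_{G,η_Z}` at its closed point, the strict transform of `Y'` base-changes to the strict transform
of the transversal curve germ `Spec 𝒪_{Y',η_Z}` (a one-dimensional excellent local domain with residue field `k(Z)`), and the components `Γ ⊆ Y'' ∩ E_Z`
dominating `Z` are the closed points of that strict transform over the closed point; then `finsum_pointDelta_strictTransform_lt` reads
`Σ_Γ δ(𝒪_{Y'',η_Γ}) < δ(𝒪_{Y',η_Z})` — the germ clock ticks strictly at every round whose centre is (or contains the generic point of) an equimultiple
curve of the trace with non-regular transversal germ. Typing this square is DONE AND PROVED in the companion `GermClockDeltaSquare.lean` (round 5; v3 crux commit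
ae8450660958, sha16 3c13707005726514, SORRY-FREE): `germDelta_round_lt` is kernel-composed from `IsBlowup.finsum_pointDelta_strictTransform_lt` +
`flat_fromSpecStalk` + `IsBlowup.pullback_snd_of_flat` with the four v2 localisation stubs all proved (`loc_curve`, `loc_centre`, `loc_transport`), and
`germDelta_round_eq_of_not_mem` (off-centre rounds: unique preimage, δ unchanged) is sorry-free; nothing of it is asserted in THIS file. -/

end Summit.ResolutionOfSingularities.ResolutionOfSingularities.Cruxes.EquisingularLiftNat.Sections.GermClock

end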